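import Literature.Probability.FitznerVanDerHofstad2017.NobleKSpaceRewrite
import Literature.Probability.FitznerVanDerHofstad2017.NoblePercolationSplit
import Literature.Probability.FitznerVanDerHofstad2017.DoubleConnectionBubble
import HarnessLib

/-!
# Fitzner–van der Hofstad [NoBLE17] App. D Steps 1–2 for `Φ` (percolation): the constants
# `c_Φ`, `α_Φ` and the `ℓ¹` bound on `R_Φ`, KERNEL-PROVED

Second module of the analytic half of [NoBLE17, Prop. 4.5(ii)] (first module:
`NobleKSpaceRewrite.lean`, which rewrites the NoBLE equation into the simplified form GIVEN constants
`c_Φ, α_Φ, c_F, α_F` with the enclosures (D.2), (D.4), (D.14) and the F-side bounds as hypotheses).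
Here the `Φ`-side hypotheses are DISCHARGED: from the split `S` of Assumption 4.3 we construct the
constants `c_Φ := Φ^α(0)`, `α_Φ := 2d·Φ^α(e_1)` of (4.18)–(4.19) (in DIRECTION-SUMMED form), prove the
enclosures (D.2) and (D.4) (`c̲_Φ ≤ c_Φ ≤ c̄_Φ = betaCPhiUp`, `|α_Φ| ≤ β_{α_Φ} = max(betaapI, betaapII)`) and
the absolute bound (D.14) `Σ_x |R_{Φ,p}(x)| ≤ β_{R_Φ} = betaRp(…)` with EXACTLY the wiring of
`BetaMap.nobleBetaOfInputs` (percolation factors `(2d−1)/(2d)` included), and assemble.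

## Main results

* `noblePhi_eq_alpha_add_rem` — the pointwise split `Φ_p = Φ^α + R_Φ` (Neumann tail of `s^Ξ`, the tails
  `Ξ_{≥2}`, `Ξ^ι_{≥1}`, and the `α`/`R` splits of the `N = 0,1` coefficients), [NoBLE17] §4.1.3;
* `noblePhiRem_l1` — `R_Φ ∈ ℓ¹` with the explicit bound `noblePhiRemBound` (sum of (D.13)-type bounds,
  the `κ`-summed relation `Σ_κ‖Ψ^κ‖₁ ≤ (2d−1)(p/μ_p)β^abs_Ξ` of `noble_sum_psi_l1`);
* `noble_cPhi_bounds` — (D.2); `noble_alphaPhi_bound` — (D.4); `noblePhiRemBound_le` — (D.14): the explicit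
  bound is dominated by `(nobleBetaOfInputs d i).βRΦ` (monotone replacement `μ_p ↦ μ̄`, `p ↦ β_{μ̄}μ_p`,
  `betaRp_ge_explicit`);
* `nobleSimplifiedFormAt_of_assumptions₂` — **theorem form of Prop. 4.5(ii), Φ-side**: the residual of
  `FitznerVanDerHofstad2016NoBLE_prop45ii` is reduced to ONE inequality on the `F`-side, the dispersive bound
  `hF : (α̲_F − β_{ΔR_F})(1 − D̂(k)) ≤ F̂_p(0) − F̂_p(k)` ((D.3) combined with (D.32)), plus the decidable sign
  side conditions (N1') `0 ≤ c̲_Φ(i)`, (N2) `β^abs_Ξ + β^abs_{Ξ^ι} < 1`, (N3) `β_Ψ(i) < 1` of module 1, plus —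
  for a general split `S` — the TRS of the shifted `α_I`-sum (`hTRS`);
* `percolationNobleSplit_xiIotaAI_shift_trs`, `nobleSimplifiedFormAt_percolation` — for the percolation
  split of [FH17-perc] §3 (`percolationNobleSplit`), `hTRS` and Assumption 4.1 are theorems.

## Readings recorded (HOME/DIVERGENCE.md D60, D61)

(a) The constants are extracted from the DIRECTION-SUMMED `Φ₀` ((4.15) summed over `ι`): `c_Φ = Φ^α(0)`,
`α_Φ = 2d Φ^α(e_η)` where `Φ^α` (`noblePhiAlpha`) collects every term of `Φ₀` supported in `‖x‖₂ ≤ 1`; the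
print's per-`ι` formulas (4.18)–(4.19) give the same numbers by symmetry.  (b) Typed Assumption 4.1
(`NobleAssumption41At`, (4.26)–(4.28)) records total rotational symmetry of `Ξ^{(N)}`, of `Σ_ι Ξ^{(N),ι}` and of
the remainder sums, but (4.16)/(4.19) silently use the TRS of the SHIFTED sum `x ↦ Σ_ι Ξ^{(0),ι}_{α,I}(x+e_ι)`
("by symmetry"); we carry it as the explicit hypothesis `hTRS` and prove it for the percolation split.  (c) The
tree's `NobleSimplifiedFormAt` demands `0 ≤ c_Φ`, which the print never states; it follows from (D.2) and the
numerical side condition (N1') `0 ≤ c̲_Φ(i)` (`c̲_Φ = 0.99889` at the published `d = 11` table, HOME/NUMERICS.md §A).  (d) In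
`NobleSimplifiedFormAt` the constant `c_F` is unconstrained and `α_F` enters only through `α̲_F ≤ α_F` and the
`β_Δ`-inequality, so the module instantiates `c_F := 0`, `α_F := α̲_F`; by `cosFT_nobleRem` the two F-side
requirements then read exactly `hF`.  This does NOT prove (D.3) or (D.32): it shows that they are needed only
in the combination `hF`, which stays the single analytic (uncited, unproved) leaf below
`FitznerVanDerHofstad2016NoBLE_prop45ii` on the Φ/F rewrite.

[cite: FitznerVanDerHofstad2016NoBLE, §4.1.3 (4.15)–(4.19) (pp. 1082–1083); Assumption 4.1 (4.26)–(4.28)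
(p. 1085); Assumption 4.3 (4.36)–(4.47) (pp. 1086–1087); Prop. 4.5 (p. 1088); App. D Step 1 (D.1)–(D.4)
(pp. 1110–1111), Step 2 (D.9)–(D.14) (pp. 1112–1113)] [cite: FitznerVanDerHofstad2017, §3.5 (EJP pp. 29–30);
§2.5 p. 16 (Percolation.nb wiring of (D.14))]
-/

noncomputable section

namespace Literature.Probability.FitznerVanDerHofstad2017

open _root_.MeasureTheory _root_.Filter _root_.Topology Literature.Probability.LatticeModels
open Literature.Barriers.CriticalPhenomena Literature.Probability.Percolation

open scoped BigOperators

variable {d : ℕ}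

/-! ## Part A. Lattice points of norm `≤ 1`, total rotational symmetry at unit vectors -/

section UnitBall

local notation "𝐞" => Literature.Probability.Percolation.stepVec

/-- A lattice point of Euclidean norm at most one is the origin or a unit vector `±e_j`. [folklore] -/
theorem eq_zero_or_eq_stepVec_of_euclidNorm_le_one {x : Site d} (hx : euclidNorm x ≤ 1) :
    x = 0 ∨ ∃ κ : Fin d × Bool, x = 𝐞 κ := by
  have hsq : ∑ i, ((x i : ℤ) : ℝ) ^ 2 ≤ 1 := by
    rw [← euclidNorm_sq]; nlinarith [euclidNorm_nonneg x]
  have hint : (∑ i, (x i) ^ 2 : ℤ) ≤ 1 := by exact_mod_cast hsq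
  by_cases h0 : x = 0
  · exact Or.inl h0
  right
  obtain ⟨j, hj⟩ : ∃ j, x j ≠ 0 := by
    obtain ⟨j, hj⟩ := Function.ne_iff.1 h0
    exact ⟨j, by simpa using hj⟩
  have htot : (x j) ^ 2 + ∑ i ∈ Finset.univ.erase j, (x i) ^ 2 = ∑ i, (x i) ^ 2 :=
    Finset.add_sum_erase Finset.univ (fun i => (x i) ^ 2) (Finset.mem_univ j)
  have hj1 : 1 ≤ (x j) ^ 2 := by
    have h1 := Int.one_le_abs hj
    nlinarith [sq_abs (x j)]
  have hrest0 : 0 ≤ ∑ i ∈ Finset.univ.erase j, (x i) ^ 2 := Finset.sum_nonneg fun i _ => sq_nonneg (x i)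
  have hrest : ∑ i ∈ Finset.univ.erase j, (x i) ^ 2 ≤ 0 := by linarith
  have hzero : ∀ i ≠ j, x i = 0 := by
    intro i hi
    have hle : (x i) ^ 2 ≤ ∑ i ∈ Finset.univ.erase j, (x i) ^ 2 :=
      Finset.single_le_sum (f := fun i => (x i) ^ 2) (fun i _ => sq_nonneg (x i))
        (Finset.mem_erase.2 ⟨hi, Finset.mem_univ i⟩)
    exact pow_eq_zero_iff two_ne_zero |>.1 (le_antisymm (hle.trans hrest) (sq_nonneg _))
  have habs : |x j| = 1 := by
    have h1 := Int.one_le_abs hj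
    have h2 : |x j| ^ 2 ≤ 1 := by rw [sq_abs]; linarith
    nlinarith
  rcases (abs_eq zero_le_one).1 habs with h | h
  · refine ⟨(j, true), funext fun i => ?_⟩
    by_cases hi : i = j
    · subst hi; simp [stepVec_eq_single, h]
    · simp [stepVec_eq_single, hi, hzero i hi]
  · refine ⟨(j, false), funext fun i => ?_⟩
    by_cases hi : i = j
    · subst hi; simp [stepVec_eq_single, h]
    · simp [stepVec_eq_single, hi, hzero i hi]

/-- `p(·;ν,δ)` maps `s e_i` to `± s e_{ν⁻¹ i}`. [folklore] -/
theorem siteSymm_single (ν : Equiv.Perm (Fin d)) (δ : Fin d → Bool) (i : Fin d) (s : ℤ) :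
    siteSymm ν δ (Pi.single i s) = Pi.single (ν.symm i) ((if δ (ν.symm i) then 1 else -1) * s) := by
  funext j
  simp only [siteSymm, Pi.single_apply]
  by_cases hj : j = ν.symm i
  · subst hj; simp
  · have : ν j ≠ i := fun h => hj (by rw [← h, Equiv.symm_apply_apply])
    simp [this, hj]

/-- A totally rotationally symmetric function takes one value on all unit vectors `e_κ`. [folklore] -/
theorem IsTRS.apply_stepVec {f : Site d → ℝ} (hf : IsTRS f) (κ κ' : Fin d × Bool) :
    f (𝐞 κ) = f (𝐞 κ') := by
  obtain ⟨i, b⟩ := κ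
  obtain ⟨i', b'⟩ := κ'
  have h := hf (Equiv.swap i i') (fun _ => decide (b = b')) (𝐞 (i', b'))
  rw [stepVec_eq_single, stepVec_eq_single]
  rw [stepVec_eq_single, siteSymm_single, Equiv.symm_swap, Equiv.swap_apply_right] at h
  simp only [] at h ⊢
  convert h using 3
  cases b <;> cases b' <;> simp

/-- The unit-sphere indicator `Σ_κ δ_{0,x−e_κ}` equals the nearest-neighbour function `nobleNN`. [folklore] -/
theorem nobleNN_eq_sum (x : Site d) : nobleNN x = ∑ κ : Fin d × Bool, nobleDelta (x - 𝐞 κ) := by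
  rw [nobleNN, Fintype.sum_prod_type]
  refine Finset.sum_congr rfl fun j _ => ?_
  rw [Fintype.sum_bool]
  simp only [Literature.Probability.Percolation.stepVec, if_true, Bool.false_eq_true, if_false, sub_neg_eq_add]

/-- `Σ_κ δ_{0,e_η−e_κ} = 1`. [folklore] -/
theorem sum_nobleDelta_stepVec_sub (η : Fin d × Bool) : ∑ κ : Fin d × Bool, nobleDelta (𝐞 η - 𝐞 κ) = 1 := by
  rw [Finset.sum_eq_single η]
  · simp [nobleDelta]
  · intro κ _ hκ
    rw [nobleDelta, if_neg]
    exact fun h => hκ (stepVec_injective' (sub_eq_zero.1 h)).symm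
  · simp

/-- `nobleNN (e_η) = 1`. [folklore] -/
theorem nobleNN_stepVec (η : Fin d × Bool) : nobleNN (𝐞 η : Site d) = 1 := by
  rw [nobleNN_eq_sum, sum_nobleDelta_stepVec_sub]

/-- `nobleNN 0 = 0`. [folklore] -/
theorem nobleNN_zero : nobleNN (0 : Site d) = 0 := by
  rw [nobleNN_eq_sum]
  exact Finset.sum_eq_zero fun κ _ => by simp [nobleDelta, stepVec_ne_zero_site κ]

/-- `nobleNN x = 0` unless `x` is a unit vector. [folklore] -/
theorem nobleNN_eq_zero {x : Site d} (hx : ∀ κ, x ≠ 𝐞 κ) : nobleNN x = 0 := by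
  rw [nobleNN_eq_sum]
  exact Finset.sum_eq_zero fun κ _ => by simp [nobleDelta, sub_eq_zero, hx κ]

/-- **A totally rotationally symmetric function supported in the unit ball is `f(0) δ + f(e₁) 𝟙_{‖x‖₂=1}`**
(the shape of every `α`-part of the split, §4.1.1). [cite: FitznerVanDerHofstad2016NoBLE, §4.1.3 (4.15)–(4.19) (pp. 1082–1083)] -/
theorem IsTRS.eq_delta_add_nn {f : Site d → ℝ} (hf : IsTRS f) (hs : ∀ x, 1 < euclidNorm x → f x = 0)
    (η : Fin d × Bool) (x : Site d) : f x = f 0 * nobleDelta x + f (𝐞 η) * nobleNN x := by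
  by_cases h1 : 1 < euclidNorm x
  · have hx0 : x ≠ 0 := by
      rintro rfl; simp at h1; exact absurd h1 (by norm_num)
    have hxκ : ∀ κ, x ≠ 𝐞 κ := by
      rintro κ rfl; rw [euclidNorm_stepVec] at h1; exact lt_irrefl _ h1
    rw [hs x h1, nobleNN_eq_zero hxκ]; simp [nobleDelta, hx0]
  rcases eq_zero_or_eq_stepVec_of_euclidNorm_le_one (not_lt.1 h1) with rfl | ⟨κ, rfl⟩
  · simp [nobleDelta, nobleNN_zero]
  · rw [nobleNN_stepVec, hf.apply_stepVec κ η]; simp [nobleDelta, stepVec_ne_zero_site]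

end UnitBall

/-! ## Part B. Generic pieces: the Neumann tail, interleaved `N`-sums, convolution linearity -/

section Generic

variable {I : Type*} [Fintype I] {A : I → I → Site d → ℝ} {u : I → Site d → ℝ}

/-- `t_{n+1}(u) = t_n(A • u)`. [folklore] -/
theorem kiter_succ_eq_kiter_kapply (A : I → I → Site d → ℝ) (u : I → Site d → ℝ) (n : ℕ) :
    kiter A u (n + 1) = kiter A (kapply A u) n := by
  induction n with
  | zero => rfl
  | succ n ih => rw [kiter_succ, ih, kiter_succ]

/-- **The Neumann series minus its seed**: `s_ι = u_ι − s_ι(A • u)` (the `n ≥ 1` terms, re-indexed), when the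
series converges absolutely at the point. [cite: FitznerVanDerHofstad2016NoBLE, App. D Step 2 ("Φ = Φ₀ + Σ_{n≥1} Φ_n", (D.13))] -/
theorem kseries_eq_seed_sub {ι : I} (h : ∀ x, Summable fun n => |kiter A u n ι x|) (x : Site d) :
    kseries A u ι x = u ι x - kseries A (kapply A u) ι x := by
  have hs : Summable fun n => (-1 : ℝ) ^ n * kiter A u n ι x := summable_negOnePow_mul (h x)
  rw [kseries, hs.tsum_eq_zero_add]
  simp only [pow_zero, one_mul, kiter_zero, pow_succ, kiter_succ_eq_kiter_kapply, kseries]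
  rw [sub_eq_add_neg, ← tsum_neg]
  congr 1
  exact tsum_congr fun n => by ring

/-- `‖(A • u)_ι‖₁ ≤ θ U`. [folklore] -/
theorem tsum_abs_kapply_le' (hA : ∀ ι κ, Summable fun x => |A ι κ x|) (hu : ∀ ι, Summable fun x => |u ι x|)
    {θ U : ℝ} (hθ : ∀ ι, ∑ κ, ∑' x, |A ι κ x| ≤ θ) (hU : ∀ ι, ∑' x, |u ι x| ≤ U) (ι : I) :
    ∑' x, |kapply A u ι x| ≤ θ * U := by
  have hU0 : 0 ≤ U := le_trans (tsum_nonneg fun _ => abs_nonneg _) (hU ι)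
  exact (tsum_abs_kapply_le hA hu hU ι).trans (mul_le_mul_of_nonneg_right (hθ ι) hU0)

/-- **The Neumann tail in `ℓ¹`**: `s_ι(A • u) ∈ ℓ¹` with `‖s_ι(A • u)‖₁ ≤ θU/(1−θ)` (the `n ≥ 1` part of the
geometric sum (D.8)/(D.13)). [cite: FitznerVanDerHofstad2016NoBLE, App. D (D.13) (p. 1112)] -/
theorem kseries_tail_l1 (hA : ∀ ι κ, Summable fun x => |A ι κ x|) (hu : ∀ ι, Summable fun x => |u ι x|)
    {θ U : ℝ} (hθ0 : 0 ≤ θ) (hθ1 : θ < 1) (hθ : ∀ ι, ∑ κ, ∑' x, |A ι κ x| ≤ θ)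
    (hU : ∀ ι, ∑' x, |u ι x| ≤ U) (ι : I) :
    (Summable fun x => |kseries A (kapply A u) ι x|) ∧
      ∑' x, |kseries A (kapply A u) ι x| ≤ θ * U / (1 - θ) :=
  kseries_l1 hA (fun ι => summable_abs_kapply hA hu ι) hθ0 hθ1 hθ
    (fun ι => tsum_abs_kapply_le' hA hu hθ hU ι) ι

omit [Fintype I] in
/-- `y ↦ f(y) g(x − y)` is summable for `f, g ∈ ℓ¹`. [folklore] -/
theorem summable_mul_shift {f g : Site d → ℝ} (hf : Summable fun x => |f x|) (hg : Summable fun x => |g x|)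
    (x : Site d) : Summable fun y => f y * g (x - y) := by
  have hgs : Summable g := summable_abs_iff.1 hg
  have hb : ∀ z, |g z| ≤ ∑' w, |g w| := fun z => hg.le_tsum z fun w _ => abs_nonneg _
  refine Summable.of_norm_bounded (hf.mul_right (∑' w, |g w|)) fun y => ?_
  rw [Real.norm_eq_abs, abs_mul]
  exact mul_le_mul_of_nonneg_left (hb _) (abs_nonneg _)

omit [Fintype I] in
/-- `f ⋆ (g − h) = f ⋆ g − f ⋆ h` pointwise (all in `ℓ¹`). [folklore] -/
theorem lconv_sub_right_abs {f g h : Site d → ℝ} (hf : Summable fun x => |f x|) (hg : Summable fun x => |g x|)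
    (hh : Summable fun x => |h x|) (x : Site d) :
    lconv f (fun z => g z - h z) x = lconv f g x - lconv f h x := by
  unfold lconv
  simp only [mul_sub]
  exact (summable_mul_shift hf hg x).tsum_sub (summable_mul_shift hf hh x)

omit [Fintype I] in
/-- Interleaving two `NSumLE` bounds: even- and odd-indexed families give the whole family. [folklore] -/
theorem NSumLE_of_even_odd {F : ℕ → Site d → ℝ} {a b : ℝ}
    (he : NSumLE (fun N x => F (2 * N) x) a) (ho : NSumLE (fun N x => F (2 * N + 1) x) b) :
    NSumLE F (a + b) := by
  obtain ⟨he1, he2, he3⟩ := he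
  obtain ⟨ho1, ho2, ho3⟩ := ho
  have h1 : ∀ N, Summable (F N) := fun N => by
    obtain ⟨m, hm | hm⟩ := Nat.even_or_odd' N
    · rw [hm]; exact he1 m
    · rw [hm]; exact ho1 m
  set g : ℕ → ℝ := fun M => ∑' x, F M x with hg
  have he2' : Summable fun N => g (2 * N) := he2
  have ho2' : Summable fun N => g (2 * N + 1) := ho2
  have h2 : Summable g := Summable.even_add_odd he2' ho2'
  refine ⟨h1, h2, ?_⟩
  have hsplit : ∑' N, g (2 * N) + ∑' N, g (2 * N + 1) = ∑' N, g N := tsum_even_add_odd he2' ho2'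
  have he3' : ∑' N, g (2 * N) ≤ a := he3
  have ho3' : ∑' N, g (2 * N + 1) ≤ b := ho3
  show ∑' N, g N ≤ a + b
  linarith

omit [Fintype I] in
/-- Shifting an absolutely convergent alternating series by two: `Σ_N (−1)^N a_N = a_0 − a_1 + Σ_N (−1)^N a_{N+2}`. [folklore] -/
theorem tsum_negOnePow_eq_shift_two {a : ℕ → ℝ} (ha : Summable a) :
    ∑' N, (-1 : ℝ) ^ N * a N = a 0 - a 1 + ∑' N, (-1 : ℝ) ^ N * a (N + 2) := by
  have hs : Summable fun N => (-1 : ℝ) ^ N * a N :=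
    Summable.of_norm_bounded ha.abs fun n => by
      rw [norm_mul, norm_pow, norm_neg, norm_one, one_pow, one_mul, Real.norm_eq_abs]
  have hs1 : Summable fun N => (-1 : ℝ) ^ (N + 1) * a (N + 1) := (summable_nat_add_iff 1).2 hs
  rw [hs.tsum_eq_zero_add, hs1.tsum_eq_zero_add]
  simp only [pow_zero, one_mul, zero_add, pow_one, neg_mul, one_mul]
  have : ∀ N, (-1 : ℝ) ^ (N + 1 + 1) * a (N + 1 + 1) = (-1 : ℝ) ^ N * a (N + 2) := fun N => by
    rw [show N + 1 + 1 = N + 2 by ring, pow_add, neg_one_sq, mul_one]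
  rw [tsum_congr this]
  ring

omit [Fintype I] in
/-- Shifting by one: `Σ_N (−1)^N a_N = a_0 − Σ_N (−1)^N a_{N+1}`. [folklore] -/
theorem tsum_negOnePow_eq_shift_one {a : ℕ → ℝ} (ha : Summable a) :
    ∑' N, (-1 : ℝ) ^ N * a N = a 0 - ∑' N, (-1 : ℝ) ^ N * a (N + 1) := by
  have hs : Summable fun N => (-1 : ℝ) ^ N * a N :=
    Summable.of_norm_bounded ha.abs fun n => by
      rw [norm_mul, norm_pow, norm_neg, norm_one, one_pow, one_mul, Real.norm_eq_abs]
  rw [hs.tsum_eq_zero_add]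
  simp only [pow_zero, one_mul, pow_succ, mul_neg_one, neg_mul]
  rw [tsum_neg, sub_eq_add_neg]

omit [Fintype I] in
/-- Closure of total rotational symmetry under linear combinations. [folklore] -/
theorem IsTRS.add {f g : Site d → ℝ} (hf : IsTRS f) (hg : IsTRS g) : IsTRS (fun x => f x + g x) :=
  fun ν δ x => by simp only [hf ν δ x, hg ν δ x]

omit [Fintype I] in
/-- Closure of total rotational symmetry under linear combinations. [folklore] -/
theorem IsTRS.sub {f g : Site d → ℝ} (hf : IsTRS f) (hg : IsTRS g) : IsTRS (fun x => f x - g x) :=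
  fun ν δ x => by simp only [hf ν δ x, hg ν δ x]

omit [Fintype I] in
/-- Closure of total rotational symmetry under linear combinations. [folklore] -/
theorem IsTRS.const_mul {f : Site d → ℝ} (hf : IsTRS f) (c : ℝ) : IsTRS (fun x => c * f x) :=
  fun ν δ x => by simp only [hf ν δ x]

omit [Fintype I] in
/-- `p(0;ν,δ) = 0`. [folklore] -/
theorem siteSymm_zero (ν : Equiv.Perm (Fin d)) (δ : Fin d → Bool) : siteSymm ν δ (0 : Site d) = 0 := by
  funext j; simp [siteSymm]

omit [Fintype I] in
/-- `p(x;ν,δ) = 0 ↔ x = 0`. [folklore] -/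
theorem siteSymm_eq_zero_iff (ν : Equiv.Perm (Fin d)) (δ : Fin d → Bool) (x : Site d) :
    siteSymm ν δ x = 0 ↔ x = 0 := by
  constructor
  · intro h
    funext j
    have := congrFun h (ν.symm j)
    simp only [siteSymm, Equiv.apply_symm_apply, Pi.zero_apply, mul_eq_zero] at this
    have hne : (if δ (ν.symm j) = true then (1 : ℤ) else -1) ≠ 0 := by
      by_cases hδ : δ (ν.symm j) = true
      · rw [if_pos hδ]; norm_num
      · rw [if_neg hδ]; norm_num
    rcases this with h1 | h1
    · exact absurd h1 hne
    · exact h1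
  · rintro rfl; exact siteSymm_zero ν δ

omit [Fintype I] in
/-- `δ_{0,x}` is totally rotationally symmetric. [folklore] -/
theorem isTRS_nobleDelta : IsTRS (nobleDelta : Site d → ℝ) :=
  fun ν δ x => by simp only [nobleDelta, siteSymm_eq_zero_iff]

end Generic

/-! ## Part C. The split `Φ_p = Φ^α + R` ([NoBLE17] §4.1.3 (4.17)–(4.19), App. D (D.9)–(D.13))

`s^Ξ_ι = w_ι − T_ι` (Neumann tail), `Ξ = Ξ^{(0)} − Ξ^{(1)} + Ξ_{≥2}`, `Ξ^ι = Ξ^{(0),ι} − Ξ^ι_{≥1}`, and the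
`N = 0, 1` coefficients split into their `α`-parts (supported in the unit ball) and remainders. -/

section PhiSplit

local notation "𝐞" => Literature.Probability.Percolation.stepVec

variable {p : unitInterval} {P X : ℝ}

/-- The Neumann tail `T_ι := s_ι(A • w)` of `s^Ξ_ι`, so that `s^Ξ_ι = w_ι − T_ι` (the `n ≥ 1` part of
(4.13)–(4.14), i.e. `Φ̂ − Φ̂₀`). [cite: FitznerVanDerHofstad2016NoBLE, §4.1.2 (4.13)–(4.14) (p. 1082); App. D (D.13)] -/
def nobleSWTail (d : ℕ) (p : unitInterval) : Fin d × Bool → Site d → ℝ :=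
  kseries (nobleKer d p) (kapply (nobleKer d p) (nobleSeedW d p))

/-- `Ξ^ι_{≥1}(x) := Σ_N (−1)^N Ξ^{(N+1),ι}(x)`, so that `Ξ^ι = Ξ^{(0),ι} − Ξ^ι_{≥1}`. [cite: FitznerVanDerHofstad2016NoBLE, App. D (D.14) ("β^abs_{Ξ^ι_α}": the `N ≥ 1` terms)] -/
def nobleXiIotaTail (d : ℕ) (p : unitInterval) (ι : Fin d × Bool) (x : Site d) : ℝ :=
  ∑' N, (-1 : ℝ) ^ N * nobleXiIotaN d p (𝐞 ι) (N + 1) x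

/-- `Ξ_{≥2}(x) := Σ_N (−1)^N Ξ^{(N+2)}(x)`, so that `Ξ = Ξ^{(0)} − Ξ^{(1)} + Ξ_{≥2}`. [cite: FitznerVanDerHofstad2016NoBLE, App. D (D.14) ("Σ_{N=2}^∞ β^{(N)}_Ξ")] -/
def nobleXiTail (d : ℕ) (p : unitInterval) (x : Site d) : ℝ :=
  ∑' N, (-1 : ℝ) ^ N * nobleXiN d p (N + 2) x

/-- **The `α`-part of `Φ_p`** (all terms supported in `‖x‖₂ ≤ 1`):
`Φ^α(x) := δ_{0,x} + Ξ_α^{(0)}(x) − Ξ_α^{(1)}(x) − μ/(1−μ²) Σ_ι (Ξ^{(0),ι}_{α,I}(x+e_ι) − μ Ξ^{(0),−ι}_{α,II}(x))`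
(the terms of `Φ₀` that (4.18)–(4.19) turn into `c_Φ δ + α_Φ D`). [cite: FitznerVanDerHofstad2016NoBLE, §4.1.3 (4.18)–(4.19) (p. 1083)] -/
def noblePhiAlpha (S : NobleSplit d p) (x : Site d) : ℝ :=
  nobleDelta x + (S.xiA 0 x - S.xiA 1 x) -
    nobleMu d p * (1 - nobleMu d p ^ 2)⁻¹ *
      ∑ ι, (S.xiIotaAI ι (x + 𝐞 ι) - nobleMu d p * S.xiIotaAII (srev ι) x)

/-- The per-direction summand of the remainder `R_Φ`: remainders `Ξ^{(0),ι}_{R,I/II}`, the tails `Ξ^ι_{≥1}`,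
the convolution `Ψ^ι ⋆ w_ι` and the Neumann tail `T_ι + Ψ^ι ⋆ T_ι`. [cite: FitznerVanDerHofstad2016NoBLE, §4.1.3 ("R_{Φ,z}(x) := Σ_{n=1}^∞ Φ_{n,z}(x) + (Φ_{0,z}(x) − c_{Φ,z}δ_{0,x} − α_{Φ,z}…)") (p. 1083)] -/
def noblePhiDirRem (S : NobleSplit d p) (ι : Fin d × Bool) (x : Site d) : ℝ :=
  -(nobleMu d p * (1 - nobleMu d p ^ 2)⁻¹ *
      (S.xiIotaRI ι (x + 𝐞 ι) - nobleMu d p * S.xiIotaRII (srev ι) x)) +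
    nobleMu d p * (1 - nobleMu d p ^ 2)⁻¹ *
      (nobleXiIotaTail d p ι (x + 𝐞 ι) - nobleMu d p * nobleXiIotaTail d p (srev ι) x) -
    nobleMu d p * lconv (noblePsi d p ι) (nobleSeedW d p ι) x +
    nobleMu d p * (nobleSWTail d p ι x + lconv (noblePsi d p ι) (nobleSWTail d p ι) x)

/-- **The remainder `R_{Φ,p} := Φ_p − Φ^α`** (before the constants are named):
`(Ξ_R^{(0)} − Ξ_R^{(1)}) + Ξ_{≥2} + Σ_ι (per-direction remainder)`. [cite: FitznerVanDerHofstad2016NoBLE, §4.1.3 (R_Φ) (p. 1083); App. D (D.13)–(D.14)] -/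
def noblePhiRem (S : NobleSplit d p) (x : Site d) : ℝ :=
  (S.xiR 0 x - S.xiR 1 x) + nobleXiTail d p x + ∑ ι, noblePhiDirRem S ι x

/-- **`Φ_p = Φ^α + R_Φ` pointwise.** [cite: FitznerVanDerHofstad2016NoBLE, §4.1.3 (4.18)–(4.19) and the definition of R_Φ (p. 1083)] -/
theorem noblePhi_eq_alpha_add_rem [NeZero d] (h : NobleL1At d p P X) (S : NobleSplit d p)
    (hΞ : ∀ x, Summable fun N => nobleXiN d p N x)
    (hΞι : ∀ ι x, Summable fun N => nobleXiIotaN d p (𝐞 ι) N x) (x : Site d) :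
    noblePhi d p x = noblePhiAlpha S x + noblePhiRem S x := by
  have hθ0 := nobleTheta_nonneg h
  have hθ1 := nobleTheta_lt_one h
  have hA := summable_abs_nobleKer h
  have hrow := nobleKer_row_le h
  have hWs := summable_abs_nobleSeedW h
  have hWle := tsum_abs_nobleSeedW_le h
  have hSWf : ∀ ι, nobleSW d p ι = fun y => nobleSeedW d p ι y - nobleSWTail d p ι y := fun ι =>
    funext fun y => kseries_eq_seed_sub ((kiter_series_l1 hA hWs hθ0 hθ1 hrow hWle ι).1) y
  have hTs : ∀ ι, Summable fun y => |nobleSWTail d p ι y| := fun ι =>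
    (kseries_tail_l1 hA hWs hθ0 hθ1 hrow hWle ι).1
  have hSW : ∀ ι, nobleSW d p ι x = nobleSeedW d p ι x - nobleSWTail d p ι x := fun ι => by
    rw [hSWf ι]
  have hconv : ∀ ι, lconv (noblePsi d p ι) (nobleSW d p ι) x =
      lconv (noblePsi d p ι) (nobleSeedW d p ι) x - lconv (noblePsi d p ι) (nobleSWTail d p ι) x :=
    fun ι => by rw [hSWf ι]; exact lconv_sub_right_abs (h.psi ι) (hWs ι) (hTs ι) x
  have hXi : nobleXi d p x = S.xiA 0 x + S.xiR 0 x - (S.xiA 1 x + S.xiR 1 x) + nobleXiTail d p x := by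
    rw [nobleXi, tsum_negOnePow_eq_shift_two (hΞ x)]
    simp only [NobleSplit.xiR, nobleXiTail]
    ring
  have hXiI : ∀ ι y, nobleXiIota d p ι y = S.xiIotaAI ι y + S.xiIotaRI ι y - nobleXiIotaTail d p ι y :=
    fun ι y => by
    rw [nobleXiIota, tsum_negOnePow_eq_shift_one (hΞι ι y)]
    simp only [NobleSplit.xiIotaRI, nobleXiIotaTail]
    ring
  have hXiII : ∀ ι y, nobleXiIota d p ι y = S.xiIotaAII ι y + S.xiIotaRII ι y - nobleXiIotaTail d p ι y :=
    fun ι y => by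
    rw [nobleXiIota, tsum_negOnePow_eq_shift_one (hΞι ι y)]
    simp only [NobleSplit.xiIotaRII, nobleXiIotaTail]
    ring
  have hW : ∀ ι, nobleSeedW d p ι x = (1 - nobleMu d p ^ 2)⁻¹ *
      ((S.xiIotaAI ι (x + 𝐞 ι) + S.xiIotaRI ι (x + 𝐞 ι) - nobleXiIotaTail d p ι (x + 𝐞 ι)) -
        nobleMu d p * (S.xiIotaAII (srev ι) x + S.xiIotaRII (srev ι) x - nobleXiIotaTail d p (srev ι) x)) :=
    fun ι => by rw [nobleSeedW, hXiI ι (x + 𝐞 ι), hXiII (srev ι) x]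
  have hdir : ∀ ι, nobleMu d p * (nobleSW d p ι x + lconv (noblePsi d p ι) (nobleSW d p ι) x) =
      nobleMu d p * (1 - nobleMu d p ^ 2)⁻¹ * (S.xiIotaAI ι (x + 𝐞 ι) - nobleMu d p * S.xiIotaAII (srev ι) x) -
        noblePhiDirRem S ι x := fun ι => by
    rw [hSW ι, hconv ι, hW ι, noblePhiDirRem]
    ring
  calc noblePhi d p x
      = nobleDelta x + nobleXi d p x -
          ∑ ι, nobleMu d p * (nobleSW d p ι x + lconv (noblePsi d p ι) (nobleSW d p ι) x) := by
        rw [noblePhi, Finset.mul_sum]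
    _ = nobleDelta x + nobleXi d p x -
          ∑ ι, (nobleMu d p * (1 - nobleMu d p ^ 2)⁻¹ *
              (S.xiIotaAI ι (x + 𝐞 ι) - nobleMu d p * S.xiIotaAII (srev ι) x) - noblePhiDirRem S ι x) := by
        rw [Finset.sum_congr rfl fun ι _ => hdir ι]
    _ = noblePhiAlpha S x + noblePhiRem S x := by
        rw [Finset.sum_sub_distrib, ← Finset.mul_sum, hXi, noblePhiAlpha, noblePhiRem]
        ring

end PhiSplit

/-! ## Part D. The `ℓ¹` bound on `R_Φ` ([NoBLE17] App. D Step 2, (D.13)–(D.14)) -/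

section PhiL1

local notation "𝐞" => Literature.Probability.Percolation.stepVec

variable {p : unitInterval}

/-! ### Small `ℓ¹` helpers -/

/-- `Σ|f + g| ≤ Σ|f| + Σ|g|`. [folklore] -/
theorem tsum_abs_add_le' {f g : Site d → ℝ} (hf : Summable fun x => |f x|) (hg : Summable fun x => |g x|) :
    ∑' x, |f x + g x| ≤ (∑' x, |f x|) + ∑' x, |g x| := by
  rw [← hf.tsum_add hg]
  exact Summable.tsum_le_tsum (fun x => abs_add_le _ _) (summable_abs_add' hf hg) (hf.add hg)

/-- `Σ|f − g| ≤ Σ|f| + Σ|g|`. [folklore] -/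
theorem tsum_abs_sub_le' {f g : Site d → ℝ} (hf : Summable fun x => |f x|) (hg : Summable fun x => |g x|) :
    ∑' x, |f x - g x| ≤ (∑' x, |f x|) + ∑' x, |g x| := by
  rw [← hf.tsum_add hg]
  exact Summable.tsum_le_tsum (fun x => abs_sub _ _) (summable_abs_sub' hf hg) (hf.add hg)

/-- `Σ_x |Σ_ι g_ι(x)| ≤ Σ_ι Σ_x |g_ι(x)|`. [folklore] -/
theorem tsum_abs_finset_sum_le {ι : Type*} (s : Finset ι) {g : ι → Site d → ℝ}
    (hg : ∀ i ∈ s, Summable fun x => |g i x|) :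
    ∑' x, |∑ i ∈ s, g i x| ≤ ∑ i ∈ s, ∑' x, |g i x| := by
  rw [← Summable.tsum_finsetSum hg]
  exact Summable.tsum_le_tsum (fun x => Finset.abs_sum_le_sum_abs _ _) (summable_abs_finset_sum' s hg)
    (summable_sum hg)

/-- `Σ_x |c f(x)| = |c| Σ_x |f(x)|`. [folklore] -/
theorem tsum_abs_const_mul' (c : ℝ) (f : Site d → ℝ) : ∑' x, |c * f x| = |c| * ∑' x, |f x| := by
  simp_rw [abs_mul]
  exact tsum_mul_left

/-- A non-negative summable function is absolutely summable with the same sum. [folklore] -/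
theorem summable_abs_of_nonneg' {f : Site d → ℝ} (h0 : ∀ x, 0 ≤ f x) (hf : Summable f) :
    (Summable fun x => |f x|) ∧ ∑' x, |f x| = ∑' x, f x := by
  have : (fun x => |f x|) = f := funext fun x => abs_of_nonneg (h0 x)
  rw [this]
  exact ⟨hf, rfl⟩

/-! ### The tails `Ξ_{≥2}`, `Ξ^ι_{≥1}` -/

variable {i : BetaMap.Inputs} {S : NobleSplit d p}

/-- `Σ_{N} Σ_x Ξ^{(N+2)}(x) ≤ β_{Ξ,even tail} + β_{Ξ,odd tail}`. [cite: FitznerVanDerHofstad2016NoBLE, App. D (D.14) (Σ_{N≥2} β^{(N)}_Ξ)] -/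
theorem NSumLE_nobleXiN_tail (h43 : NobleAssumption43At d p S i) :
    NSumLE (fun N x => nobleXiN d p (N + 2) x) (i.xiEvenTail + i.xiOddTail) := by
  refine NSumLE_of_even_odd (F := fun N x => nobleXiN d p (N + 2) x) ?_ ?_
  · have : (fun N x => nobleXiN d p (2 * N + 2) x) = fun N x => (fun N x => nobleXiN d p (N + 2) x) (2 * N) x := by
      funext N x; rfl
    simpa only using h43.xiEvenTail
  · have : (fun N x => (fun N x => nobleXiN d p (N + 2) x) (2 * N + 1) x) = fun N x => nobleXiN d p (2 * N + 3) x := by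
      funext N x; simp only [show 2 * N + 1 + 2 = 2 * N + 3 by ring]
    rw [this]
    exact h43.xiOddTail

/-- `Σ_{N} Σ_x Ξ^{(N+1),ι}(x) ≤ β_{Ξ^ι,odd} + β_{Ξ^ι,even tail}`. [cite: FitznerVanDerHofstad2016NoBLE, App. D (D.14) (β^abs_{Ξ^ι_α}, the N ≥ 1 terms)] -/
theorem NSumLE_nobleXiIotaN_tail (h43 : NobleAssumption43At d p S i) (ι : Fin d × Bool) :
    NSumLE (fun N x => nobleXiIotaN d p (𝐞 ι) (N + 1) x) (i.xiIotaOdd + i.xiIotaEvenTail) := by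
  refine NSumLE_of_even_odd (F := fun N x => nobleXiIotaN d p (𝐞 ι) (N + 1) x) ?_ ?_
  · exact h43.xiIotaOdd ι
  · have : (fun N x => (fun N x => nobleXiIotaN d p (𝐞 ι) (N + 1) x) (2 * N + 1) x) =
        fun N x => nobleXiIotaN d p (𝐞 ι) (2 * N + 2) x := by
      funext N x; simp only [show 2 * N + 1 + 1 = 2 * N + 2 by ring]
    rw [this]
    exact h43.xiIotaEvenTail ι

/-- `Ξ_{≥2} ∈ ℓ¹` with `Σ_x |Ξ_{≥2}(x)| ≤ β_{Ξ,even tail} + β_{Ξ,odd tail}`. [cite: FitznerVanDerHofstad2016NoBLE, App. D (D.14)] -/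
theorem nobleXiTail_l1 (h43 : NobleAssumption43At d p S i) :
    (Summable fun x => |nobleXiTail d p x|) ∧ ∑' x, |nobleXiTail d p x| ≤ i.xiEvenTail + i.xiOddTail := by
  have h := alternating_of_NSumLE (fun N x => nobleXiN_nonneg p (N + 2) x) (NSumLE_nobleXiN_tail h43)
  exact ⟨h.1, h.2.1⟩

/-- `Ξ^ι_{≥1} ∈ ℓ¹` with `Σ_x |Ξ^ι_{≥1}(x)| ≤ β_{Ξ^ι,odd} + β_{Ξ^ι,even tail}`. [cite: FitznerVanDerHofstad2016NoBLE, App. D (D.14)] -/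
theorem nobleXiIotaTail_l1 (h43 : NobleAssumption43At d p S i) (ι : Fin d × Bool) :
    (Summable fun x => |nobleXiIotaTail d p ι x|) ∧
      ∑' x, |nobleXiIotaTail d p ι x| ≤ i.xiIotaOdd + i.xiIotaEvenTail := by
  have h := alternating_of_NSumLE (fun N x => nobleXiIotaN_nonneg p (𝐞 ι) (N + 1) x)
    (NSumLE_nobleXiIotaN_tail h43 ι)
  exact ⟨h.1, h.2.1⟩

/-! ### The remainders `Ξ^{(0),ι}_{R,I}`, `Ξ^{(0),ι}_{R,II}` -/

/-- `Ξ^{(0),ι}_{R,I} ≥ 0`. [cite: FitznerVanDerHofstad2016NoBLE, §4.1.1 ("non-negative functions")] -/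
theorem NobleSplit.xiIotaRI_nonneg (S : NobleSplit d p) (ι : Fin d × Bool) (x : Site d) : 0 ≤ S.xiIotaRI ι x :=
  sub_nonneg.2 (S.xiIotaAI_le ι x)

/-- `Ξ^{(0),ι}_{R,II} ≥ 0`. [cite: FitznerVanDerHofstad2016NoBLE, §4.1.1 ("non-negative functions")] -/
theorem NobleSplit.xiIotaRII_nonneg (S : NobleSplit d p) (ι : Fin d × Bool) (x : Site d) :
    0 ≤ S.xiIotaRII ι x :=
  sub_nonneg.2 (S.xiIotaAII_le ι x)

/-- `Ξ^{(0),ι}_{R,I} ∈ ℓ¹`, `Σ_x |Ξ^{(0),ι}_{R,I}(x)| ≤ β^{(0)}_{Ξ^ι,R,I}`. [cite: FitznerVanDerHofstad2016NoBLE, Assumption 4.3 (4.46) (p. 1087)] -/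
theorem xiIotaRI_l1 (h43 : NobleAssumption43At d p S i) (ι : Fin d × Bool) :
    (Summable fun x => |S.xiIotaRI ι x|) ∧ ∑' x, |S.xiIotaRI ι x| ≤ i.xiIotaRI0 := by
  obtain ⟨hs, heq⟩ := summable_abs_of_nonneg' (S.xiIotaRI_nonneg ι) (h43.xiIotaRI0 ι).1
  exact ⟨hs, heq ▸ (h43.xiIotaRI0 ι).2⟩

/-- `Ξ^{(0),ι}_{R,II} ∈ ℓ¹`, `Σ_x |Ξ^{(0),ι}_{R,II}(x)| ≤ β^{(0)}_{Ξ^ι,R,II}`. [cite: FitznerVanDerHofstad2016NoBLE, Assumption 4.3 (4.47) (p. 1087)] -/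
theorem xiIotaRII_l1 (h43 : NobleAssumption43At d p S i) (ι : Fin d × Bool) :
    (Summable fun x => |S.xiIotaRII ι x|) ∧ ∑' x, |S.xiIotaRII ι x| ≤ i.xiIotaRII0 := by
  obtain ⟨hs, heq⟩ := summable_abs_of_nonneg' (S.xiIotaRII_nonneg ι) (h43.xiIotaRII0 ι).1
  exact ⟨hs, heq ▸ (h43.xiIotaRII0 ι).2⟩

/-- `Ξ^{(N)}_R ∈ ℓ¹` (`N = 0,1`), `Σ_x |Ξ^{(N)}_R(x)| ≤ β^{(N)}_{Ξ,R}`. [cite: FitznerVanDerHofstad2016NoBLE, Assumption 4.3 (4.43) (p. 1087)] -/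
theorem xiR_l1 (h43 : NobleAssumption43At d p S i) :
    (Summable fun x => |S.xiR 0 x|) ∧ ∑' x, |S.xiR 0 x| ≤ i.xiR0 ∧
      (Summable fun x => |S.xiR 1 x|) ∧ ∑' x, |S.xiR 1 x| ≤ i.xiR1 := by
  obtain ⟨hs0, he0⟩ := summable_abs_of_nonneg' (fun x => S.xiR_nonneg zero_le_one x) h43.xiR0.1
  obtain ⟨hs1, he1⟩ := summable_abs_of_nonneg' (fun x => S.xiR_nonneg le_rfl x) h43.xiR1.1
  exact ⟨hs0, he0 ▸ h43.xiR0.2, hs1, he1 ▸ h43.xiR1.2⟩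

/-! ### `Σ_κ ‖Ψ^κ‖₁ ≤ (2d−1)(μ̄/μ) β^abs_Ξ` (the κ-summed relation, App. D (D.5)) -/

variable (hd : 2 ≤ d) (hp : p < criticalProbI d)
include hd hp

/-- **`Σ_κ Σ_x |Ψ^κ_p(x)| ≤ (2d−1) (p/μ_p) β^abs_Ξ`** (the direction-summed Assumption 4.2, as used in
App. D with "μ Σ_κ Ψ̂^κ ≤ (2d−1) μ̄ β_Ξ"). [cite: FitznerVanDerHofstad2016NoBLE, App. D (D.5), (D.13)–(D.14) (pp. 1111–1113)] -/
theorem noble_sum_psi_l1 (hp0 : 0 < (p : ℝ)) (h43 : NobleAssumption43At d p S i) :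
    (∀ κ, Summable fun x => |noblePsi d p κ x|) ∧
      ∑ κ, ∑' x, |noblePsi d p κ x| ≤ (2 * d - 1) * ((p : ℝ) / nobleMu d p) * i.xiAbs := by
  have hRel := nobleRelationSummedAt_of_lt_criticalProbI hd hp0 hp
  have hK := l1_of_NSumLE (fun N x => Finset.sum_nonneg fun κ _ => noblePsiN_nonneg' p (𝐞 κ) (id N) x)
    (NSumLE_sum_noblePsiN hd hRel (M := id) h43.xiAbs)
  have hκ := fun κ => l1_of_NSumLE (fun N x => noblePsiN_nonneg' p (𝐞 κ) (id N) x)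
    (NSumLE_noblePsiN hd hp (M := id) h43.xiAbs κ)
  have hκa := fun κ => alternating_of_NSumLE (fun N x => noblePsiN_nonneg' p (𝐞 κ) (id N) x)
    (NSumLE_noblePsiN hd hp (M := id) h43.xiAbs κ)
  refine ⟨fun κ => (hκa κ).1, ?_⟩
  have h1 : ∀ κ, ∑' x, |noblePsi d p κ x| ≤ ∑' x, ∑' N, noblePsiN d p (𝐞 κ) N x := fun κ =>
    Summable.tsum_le_tsum (fun x => abs_alternating_tsum_le ((hκ κ).1 x) fun N => noblePsiN_nonneg' p _ N x)
      (hκa κ).1 (hκ κ).2.1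
  calc ∑ κ, ∑' x, |noblePsi d p κ x| ≤ ∑ κ, ∑' x, ∑' N, noblePsiN d p (𝐞 κ) N x :=
        Finset.sum_le_sum fun κ _ => h1 κ
    _ = ∑' x, ∑ κ, ∑' N, noblePsiN d p (𝐞 κ) N x :=
        (Summable.tsum_finsetSum fun κ _ => (hκ κ).2.1).symm
    _ = ∑' x, ∑' N, ∑ κ, noblePsiN d p (𝐞 κ) N x :=
        tsum_congr fun x => (Summable.tsum_finsetSum fun κ _ => (hκ κ).1 x).symm
    _ ≤ (2 * d - 1) * ((p : ℝ) / nobleMu d p) * i.xiAbs := hK.2.2.2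

/-! ### The per-direction remainder and `R_Φ` in `ℓ¹` -/

/-- The explicit `ℓ¹` bound on `R_Φ` in terms of `μ_p`, `p` and the Assumption-4.3 constants (before the
monotone replacement `μ_p ↦ Γ-bound`, `p ↦ μ̄`-bound of App. D): `partOfXi + (T3,T4 terms) + (T5) + (T6)`.
[cite: FitznerVanDerHofstad2016NoBLE, App. D (D.13)–(D.14) (pp. 1112–1113)] -/
def noblePhiRemBound (d : ℕ) (p : unitInterval) (i : BetaMap.Inputs) (ΨS : ℝ) : ℝ :=
  (i.xiR0 + i.xiR1) + (i.xiEvenTail + i.xiOddTail) +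
    2 * d * (nobleMu d p * (1 - nobleMu d p ^ 2)⁻¹ * (i.xiIotaRI0 + nobleMu d p * i.xiIotaRII0) +
      nobleMu d p * (1 - nobleMu d p ^ 2)⁻¹ * (1 + nobleMu d p) * (i.xiIotaOdd + i.xiIotaEvenTail) +
      nobleMu d p * ((2 * d - 1) * (p : ℝ) * i.xiIotaAbs / (1 - nobleMu d p) *
        ((1 - nobleMu d p ^ 2)⁻¹ * ((1 + nobleMu d p) * i.xiIotaAbs)) /
        (1 - (2 * d - 1) * (p : ℝ) * i.xiIotaAbs / (1 - nobleMu d p)))) +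
    nobleMu d p * ((1 - nobleMu d p ^ 2)⁻¹ * ((1 + nobleMu d p) * i.xiIotaAbs) +
      (2 * d - 1) * (p : ℝ) * i.xiIotaAbs / (1 - nobleMu d p) *
        ((1 - nobleMu d p ^ 2)⁻¹ * ((1 + nobleMu d p) * i.xiIotaAbs)) /
        (1 - (2 * d - 1) * (p : ℝ) * i.xiIotaAbs / (1 - nobleMu d p))) * ΨS

/-- **Per-direction remainder in `ℓ¹`.** With `c = μ/(1−μ²)`, `U = (1+μ)β^abs_{Ξ^ι}/(1−μ²)`,
`θ = (2d−1)μ̄β^abs_{Ξ^ι}/(1−μ)`, `T = θU/(1−θ)`, `ψ₁^ι = Σ_x|Ψ^ι(x)|`: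
`Σ_x |r^ι(x)| ≤ c(β_{R,I} + μβ_{R,II}) + c(1+μ)(β^odd+β^even tail) + μ ψ₁^ι U + μ(1+ψ₁^ι) T`.
[cite: FitznerVanDerHofstad2016NoBLE, App. D (D.13)–(D.14) (pp. 1112–1113)] -/
theorem noblePhiDirRem_l1 [NeZero d] (hp0 : 0 < (p : ℝ)) (h43 : NobleAssumption43At d p S i)
    (ι : Fin d × Bool) :
    (Summable fun x => |noblePhiDirRem S ι x|) ∧
      ∑' x, |noblePhiDirRem S ι x| ≤
        nobleMu d p * (1 - nobleMu d p ^ 2)⁻¹ * (i.xiIotaRI0 + nobleMu d p * i.xiIotaRII0) +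
        nobleMu d p * (1 - nobleMu d p ^ 2)⁻¹ * (1 + nobleMu d p) * (i.xiIotaOdd + i.xiIotaEvenTail) +
        nobleMu d p * (∑' x, |noblePsi d p ι x|) * ((1 - nobleMu d p ^ 2)⁻¹ * ((1 + nobleMu d p) * i.xiIotaAbs)) +
        nobleMu d p * (1 + ∑' x, |noblePsi d p ι x|) *
          ((2 * d - 1) * (p : ℝ) * i.xiIotaAbs / (1 - nobleMu d p) *
            ((1 - nobleMu d p ^ 2)⁻¹ * ((1 + nobleMu d p) * i.xiIotaAbs)) /
            (1 - (2 * d - 1) * (p : ℝ) * i.xiIotaAbs / (1 - nobleMu d p))) := by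
  have h := nobleL1At_of_assumption43 hd hp hp0 h43
  have hμ0 := nobleMu_nonneg d p
  have hq := one_sub_mu_sq_pos h
  have hc0 : 0 ≤ nobleMu d p * (1 - nobleMu d p ^ 2)⁻¹ := mul_nonneg hμ0 (inv_pos.2 hq).le
  have hθ0 := nobleTheta_nonneg h
  have hθ1 := nobleTheta_lt_one h
  have hA := summable_abs_nobleKer h
  have hrow := nobleKer_row_le h
  have hWs := summable_abs_nobleSeedW h
  have hWle := tsum_abs_nobleSeedW_le h
  have hT : (Summable fun x => |nobleSWTail d p ι x|) ∧ ∑' x, |nobleSWTail d p ι x| ≤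
      (2 * d - 1) * (p : ℝ) * i.xiIotaAbs / (1 - nobleMu d p) *
        ((1 - nobleMu d p ^ 2)⁻¹ * ((1 + nobleMu d p) * i.xiIotaAbs)) /
        (1 - (2 * d - 1) * (p : ℝ) * i.xiIotaAbs / (1 - nobleMu d p)) :=
    kseries_tail_l1 hA hWs hθ0 hθ1 hrow hWle ι
  -- abbreviations
  set c : ℝ := nobleMu d p * (1 - nobleMu d p ^ 2)⁻¹ with hc
  set U : ℝ := (1 - nobleMu d p ^ 2)⁻¹ * ((1 + nobleMu d p) * i.xiIotaAbs) with hU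
  set Tb : ℝ := (2 * d - 1) * (p : ℝ) * i.xiIotaAbs / (1 - nobleMu d p) * U /
      (1 - (2 * d - 1) * (p : ℝ) * i.xiIotaAbs / (1 - nobleMu d p)) with hTb
  set ψ1 : ℝ := ∑' x, |noblePsi d p ι x| with hψ1
  have hψ1_0 : 0 ≤ ψ1 := tsum_nonneg fun _ => abs_nonneg _
  set t1 : Site d → ℝ := fun x => c * (S.xiIotaRI ι (x + 𝐞 ι) - nobleMu d p * S.xiIotaRII (srev ι) x) with ht1
  set t2 : Site d → ℝ := fun x =>
    c * (nobleXiIotaTail d p ι (x + 𝐞 ι) - nobleMu d p * nobleXiIotaTail d p (srev ι) x) with ht2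
  set t3 : Site d → ℝ := fun x => nobleMu d p * lconv (noblePsi d p ι) (nobleSeedW d p ι) x with ht3
  set t4 : Site d → ℝ := fun x =>
    nobleMu d p * (nobleSWTail d p ι x + lconv (noblePsi d p ι) (nobleSWTail d p ι) x) with ht4
  have hrem : ∀ x, noblePhiDirRem S ι x = -t1 x + t2 x - t3 x + t4 x := fun x => rfl
  -- ℓ¹ of each
  obtain ⟨hRIs, hRIle⟩ := xiIotaRI_l1 h43 ι
  obtain ⟨hRIIs, hRIIle⟩ := xiIotaRII_l1 h43 (srev ι)
  obtain ⟨hX1s, hX1le⟩ := nobleXiIotaTail_l1 h43 ι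
  obtain ⟨hX2s, hX2le⟩ := nobleXiIotaTail_l1 h43 (srev ι)
  have h1s : Summable fun x => |t1 x| := summable_abs_const_mul' _
    (summable_abs_sub' (summable_abs_comp_add_right hRIs _) (summable_abs_const_mul' _ hRIIs))
  have h1le : ∑' x, |t1 x| ≤ c * (i.xiIotaRI0 + nobleMu d p * i.xiIotaRII0) := by
    have := tsum_abs_smul_sub_le c (nobleMu d p) (summable_abs_comp_add_right hRIs (𝐞 ι)) hRIIs
    rw [tsum_abs_comp_add_right, abs_of_nonneg hc0, abs_of_nonneg hμ0] at this
    exact this.trans (mul_le_mul_of_nonneg_left (add_le_add hRIle (mul_le_mul_of_nonneg_left hRIIle hμ0)) hc0)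
  have h2s : Summable fun x => |t2 x| := summable_abs_const_mul' _
    (summable_abs_sub' (summable_abs_comp_add_right hX1s _) (summable_abs_const_mul' _ hX2s))
  have h2le : ∑' x, |t2 x| ≤ c * (1 + nobleMu d p) * (i.xiIotaOdd + i.xiIotaEvenTail) := by
    have := tsum_abs_smul_sub_le c (nobleMu d p) (summable_abs_comp_add_right hX1s (𝐞 ι)) hX2s
    rw [tsum_abs_comp_add_right, abs_of_nonneg hc0, abs_of_nonneg hμ0] at this
    refine this.trans ?_
    calc c * ((∑' x, |nobleXiIotaTail d p ι x|) + nobleMu d p * ∑' x, |nobleXiIotaTail d p (srev ι) x|)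
        ≤ c * ((i.xiIotaOdd + i.xiIotaEvenTail) + nobleMu d p * (i.xiIotaOdd + i.xiIotaEvenTail)) :=
          mul_le_mul_of_nonneg_left (add_le_add hX1le (mul_le_mul_of_nonneg_left hX2le hμ0)) hc0
      _ = c * (1 + nobleMu d p) * (i.xiIotaOdd + i.xiIotaEvenTail) := by ring
  have h3s : Summable fun x => |t3 x| := summable_abs_const_mul' _ (summable_abs_lconv (h.psi ι) (hWs ι))
  have h3le : ∑' x, |t3 x| ≤ nobleMu d p * ψ1 * U := by
    rw [ht3, tsum_abs_const_mul', abs_of_nonneg hμ0, mul_assoc]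
    refine mul_le_mul_of_nonneg_left ((tsum_abs_lconv_le (h.psi ι) (hWs ι)).trans ?_) hμ0
    exact mul_le_mul_of_nonneg_left (hWle ι) hψ1_0
  have h4s : Summable fun x => |t4 x| := summable_abs_const_mul' _
    (summable_abs_add' hT.1 (summable_abs_lconv (h.psi ι) hT.1))
  have hTl : ∑' x, |lconv (noblePsi d p ι) (nobleSWTail d p ι) x| ≤ ψ1 * ∑' x, |nobleSWTail d p ι x| :=
    tsum_abs_lconv_le (h.psi ι) hT.1
  have h4le : ∑' x, |t4 x| ≤ nobleMu d p * (1 + ψ1) * Tb := by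
    rw [ht4, tsum_abs_const_mul', abs_of_nonneg hμ0, mul_assoc]
    refine mul_le_mul_of_nonneg_left ((tsum_abs_add_le' hT.1 (summable_abs_lconv (h.psi ι) hT.1)).trans ?_) hμ0
    have hT0 : 0 ≤ ∑' x, |nobleSWTail d p ι x| := tsum_nonneg fun _ => abs_nonneg _
    have hTb' : ∑' x, |nobleSWTail d p ι x| ≤ Tb := hT.2
    nlinarith
  -- assemble
  have h1s' : Summable fun x => |-t1 x| := by simpa only [abs_neg] using h1s
  have hs12 : Summable fun x => |-t1 x + t2 x| := summable_abs_add' h1s' h2s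
  have hs123 : Summable fun x => |-t1 x + t2 x - t3 x| := summable_abs_sub' hs12 h3s
  have hs : Summable fun x => |-t1 x + t2 x - t3 x + t4 x| := summable_abs_add' hs123 h4s
  refine ⟨by simp only [hrem]; exact hs, ?_⟩
  rw [tsum_congr fun x => congrArg abs (hrem x)]
  have e1 : ∑' x, |-t1 x + t2 x| ≤ (∑' x, |-t1 x|) + ∑' x, |t2 x| := tsum_abs_add_le' h1s' h2s
  have e1' : ∑' x, |-t1 x| = ∑' x, |t1 x| := tsum_congr fun x => abs_neg _
  have e2 : ∑' x, |-t1 x + t2 x - t3 x| ≤ (∑' x, |-t1 x + t2 x|) + ∑' x, |t3 x| := tsum_abs_sub_le' hs12 h3s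
  have e3 : ∑' x, |-t1 x + t2 x - t3 x + t4 x| ≤ (∑' x, |-t1 x + t2 x - t3 x|) + ∑' x, |t4 x| :=
    tsum_abs_add_le' hs123 h4s
  linarith

/-- **`R_Φ ∈ ℓ¹(ℤ^d)` with the explicit bound `noblePhiRemBound`** (sum of the per-direction bounds over the
`2d` directions, `Σ_ι ψ₁^ι ≤ Ψ_S`). [cite: FitznerVanDerHofstad2016NoBLE, App. D (D.13)–(D.14) (pp. 1112–1113)] -/
theorem noblePhiRem_l1 [NeZero d] (hp0 : 0 < (p : ℝ)) (h43 : NobleAssumption43At d p S i) :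
    (Summable fun x => |noblePhiRem S x|) ∧
      ∑' x, |noblePhiRem S x| ≤
        noblePhiRemBound d p i ((2 * d - 1) * ((p : ℝ) / nobleMu d p) * i.xiAbs) := by
  have h := nobleL1At_of_assumption43 hd hp hp0 h43
  have hμ0 := nobleMu_nonneg d p
  have hq := one_sub_mu_sq_pos h
  have hθ0 := nobleTheta_nonneg h
  have hθ1 := nobleTheta_lt_one h
  have hcard : (Fintype.card (Fin d × Bool) : ℝ) = 2 * d := by
    rw [Fintype.card_prod, Fintype.card_fin, Fintype.card_bool]; push_cast; ring
  obtain ⟨hR0s, hR0le, hR1s, hR1le⟩ := xiR_l1 h43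
  obtain ⟨hXs, hXle⟩ := nobleXiTail_l1 h43
  have hdir := fun ι => noblePhiDirRem_l1 hd hp hp0 h43 ι
  obtain ⟨-, hψle⟩ := noble_sum_psi_l1 hd hp hp0 h43
  have hs1 : Summable fun x => |S.xiR 0 x - S.xiR 1 x| := summable_abs_sub' hR0s hR1s
  have hs2 : Summable fun x => |S.xiR 0 x - S.xiR 1 x + nobleXiTail d p x| := summable_abs_add' hs1 hXs
  have hs3 : Summable fun x => |∑ ι, noblePhiDirRem S ι x| :=
    summable_abs_finset_sum' _ fun ι _ => (hdir ι).1
  have hs : Summable fun x => |noblePhiRem S x| := summable_abs_add' hs2 hs3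
  refine ⟨hs, ?_⟩
  have e1 : ∑' x, |S.xiR 0 x - S.xiR 1 x| ≤ (∑' x, |S.xiR 0 x|) + ∑' x, |S.xiR 1 x| :=
    tsum_abs_sub_le' hR0s hR1s
  have e2 : ∑' x, |S.xiR 0 x - S.xiR 1 x + nobleXiTail d p x| ≤
      (∑' x, |S.xiR 0 x - S.xiR 1 x|) + ∑' x, |nobleXiTail d p x| := tsum_abs_add_le' hs1 hXs
  have e3 : ∑' x, |S.xiR 0 x - S.xiR 1 x + nobleXiTail d p x + ∑ ι, noblePhiDirRem S ι x| ≤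
      (∑' x, |S.xiR 0 x - S.xiR 1 x + nobleXiTail d p x|) + ∑' x, |∑ ι, noblePhiDirRem S ι x| :=
    tsum_abs_add_le' hs2 hs3
  have e4 : ∑' x, |∑ ι, noblePhiDirRem S ι x| ≤ ∑ ι, ∑' x, |noblePhiDirRem S ι x| :=
    tsum_abs_finset_sum_le (Finset.univ : Finset (Fin d × Bool)) fun ι _ => (hdir ι).1
  -- constants
  set U : ℝ := (1 - nobleMu d p ^ 2)⁻¹ * ((1 + nobleMu d p) * i.xiIotaAbs) with hU
  set θ : ℝ := (2 * d - 1) * (p : ℝ) * i.xiIotaAbs / (1 - nobleMu d p) with hθ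
  set Tb : ℝ := θ * U / (1 - θ) with hTb
  set ΨS : ℝ := (2 * d - 1) * ((p : ℝ) / nobleMu d p) * i.xiAbs with hΨS
  set K : ℝ := nobleMu d p * (1 - nobleMu d p ^ 2)⁻¹ * (i.xiIotaRI0 + nobleMu d p * i.xiIotaRII0) +
    nobleMu d p * (1 - nobleMu d p ^ 2)⁻¹ * (1 + nobleMu d p) * (i.xiIotaOdd + i.xiIotaEvenTail) +
    nobleMu d p * Tb with hK
  set L : ℝ := nobleMu d p * (U + Tb) with hL
  have hX0 : 0 ≤ i.xiIotaAbs :=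
    NSumLE_nonneg (fun N x => nobleXiIotaN_nonneg p _ N x) (h43.xiIotaAbs ((⟨0, by omega⟩ : Fin d), true))
  have hU0 : 0 ≤ U := mul_nonneg (inv_pos.2 hq).le (mul_nonneg (by linarith) hX0)
  have hTb0 : 0 ≤ Tb := div_nonneg (mul_nonneg hθ0 hU0) (by linarith)
  have hL0 : 0 ≤ L := mul_nonneg hμ0 (add_nonneg hU0 hTb0)
  have e5 : ∑ ι, ∑' x, |noblePhiDirRem S ι x| ≤ ∑ ι : Fin d × Bool, (K + L * ∑' x, |noblePsi d p ι x|) :=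
    Finset.sum_le_sum fun ι _ => (hdir ι).2.trans (le_of_eq (by simp only [hK, hL]; ring))
  have e6 : ∑ ι : Fin d × Bool, (K + L * ∑' x, |noblePsi d p ι x|) =
      2 * d * K + L * ∑ ι, ∑' x, |noblePsi d p ι x| := by
    rw [Finset.sum_add_distrib, Finset.sum_const, Finset.card_univ, ← Finset.mul_sum]
    simp only [nsmul_eq_mul, hcard]
  have e7 : L * ∑ ι, ∑' x, |noblePsi d p ι x| ≤ L * ΨS := mul_le_mul_of_nonneg_left hψle hL0
  have goal_eq : noblePhiRemBound d p i ΨS =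
      (i.xiR0 + i.xiR1) + (i.xiEvenTail + i.xiOddTail) + 2 * d * K + L * ΨS := by
    simp only [noblePhiRemBound, hK, hL, hTb, hθ, hU]
  rw [goal_eq]
  unfold noblePhiRem
  linarith

end PhiL1

/-! ## Part E. The constants `c_Φ = Φ^α(0)`, `α_Φ = 2d Φ^α(e_η)` and the bounds (D.2), (D.4) -/

section PhiAlpha

local notation "𝐞" => Literature.Probability.Percolation.stepVec

variable {p : unitInterval} {i : BetaMap.Inputs} {S : NobleSplit d p}

/-- A direction sum of a constant: `Σ_{κ : Fin d × Bool} c = 2d·c`. [folklore] -/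
theorem sum_const_dir (d : ℕ) (c : ℝ) : ∑ _κ : Fin d × Bool, c = 2 * d * c := by
  rw [Finset.sum_const, Finset.card_univ, nsmul_eq_mul, Fintype.card_prod, Fintype.card_fin, Fintype.card_bool]
  push_cast
  ring

/-- For a totally rotationally symmetric `f`: `2d · f(e_η) = Σ_κ f(e_κ)`. [folklore] -/
theorem IsTRS.two_d_mul_apply_stepVec {f : Site d → ℝ} (hf : IsTRS f) (η : Fin d × Bool) :
    2 * d * f (𝐞 η) = ∑ κ : Fin d × Bool, f (𝐞 κ) := by
  rw [Finset.sum_congr rfl fun κ _ => hf.apply_stepVec κ η, sum_const_dir]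

/-- `x ↦ Σ_ι Ξ^{(0),−ι}_{α,II}(x) = Σ_ι Ξ^{(0),ι}(x) − Σ_ι Ξ^{(0),ι}_{R,II}(x)` is totally rotationally symmetric
under Assumption 4.1. [cite: FitznerVanDerHofstad2016NoBLE, Assumption 4.1 (4.27) (p. 1085)] -/
theorem isTRS_sum_xiIotaAII_srev (h41 : NobleAssumption41At d p S) :
    IsTRS (fun x => ∑ ι, S.xiIotaAII (srev ι) x) := by
  have h1 : (fun x => ∑ ι, S.xiIotaAII (srev ι) x) =
      fun x => (∑ ι, nobleXiIotaN d p (𝐞 ι) 0 x) - ∑ ι, S.xiIotaRII ι x := by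
    funext x
    rw [← Finset.sum_sub_distrib]
    exact Fintype.sum_equiv (srevEquiv d) _ _ fun ι => by
      simp only [NobleSplit.xiIotaRII, srevEquiv, Equiv.coe_fn_mk, sub_sub_cancel]
  rw [h1]
  exact (h41.xiIotaSum_trs 0).sub h41.xiIotaRIISum_trs

/-- `Ξ^{(N)}_α = Ξ^{(N)} − Ξ^{(N)}_R` (`N = 0, 1`) is totally rotationally symmetric under Assumption 4.1.
[cite: FitznerVanDerHofstad2016NoBLE, Assumption 4.1 (4.27) (p. 1085)] -/
theorem isTRS_xiA (h41 : NobleAssumption41At d p S) (N : ℕ) (hN : N ≤ 1) : IsTRS (S.xiA N) := by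
  have h1 : S.xiA N = fun x => nobleXiN d p N x - S.xiR N x := by
    funext x; simp only [NobleSplit.xiR, sub_sub_cancel]
  rw [h1]
  exact (h41.xi_trs N).sub (h41.xiR_trs N hN)

/-- **`Φ^α` is totally rotationally symmetric** (given the TRS of the shifted `α_I`-sum, hypothesis `hTRS`;
for the percolation split this is `percolationNobleSplit_xiIotaAI_shift_trs` below).
[cite: FitznerVanDerHofstad2016NoBLE, §4.1.3 (4.16)–(4.19) (p. 1083); Assumption 4.1 (p. 1085)] -/
theorem isTRS_noblePhiAlpha (h41 : NobleAssumption41At d p S)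
    (hTRS : IsTRS (fun x => ∑ ι, S.xiIotaAI ι (x + 𝐞 ι))) : IsTRS (noblePhiAlpha S) := by
  have h1 : noblePhiAlpha S = fun x => nobleDelta x + (S.xiA 0 x - S.xiA 1 x) -
      nobleMu d p * (1 - nobleMu d p ^ 2)⁻¹ *
        ((∑ ι, S.xiIotaAI ι (x + 𝐞 ι)) - nobleMu d p * ∑ ι, S.xiIotaAII (srev ι) x) := by
    funext x; rw [noblePhiAlpha, Finset.sum_sub_distrib, Finset.mul_sum]
  rw [h1]
  exact (isTRS_nobleDelta.add ((isTRS_xiA h41 0 zero_le_one).sub (isTRS_xiA h41 1 le_rfl))).sub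
    ((hTRS.sub ((isTRS_sum_xiIotaAII_srev h41).const_mul _)).const_mul _)

/-- **`Φ^α` is supported in the unit ball.** [cite: FitznerVanDerHofstad2016NoBLE, §4.1.1 ("terms for which either
|x| ≤ 1 or |x − e_ι| ≤ 1"), §4.1.3 (4.16) (pp. 1080, 1083)] -/
theorem noblePhiAlpha_support (S : NobleSplit d p) (x : Site d) (hx : 1 < euclidNorm x) :
    noblePhiAlpha S x = 0 := by
  have hx0 : x ≠ 0 := by rintro rfl; rw [euclidNorm_zero'] at hx; linarith
  rw [noblePhiAlpha, S.xiA_support 0 zero_le_one x hx, S.xiA_support 1 le_rfl x hx,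
    Finset.sum_eq_zero (fun ι _ => by rw [S.xiIotaAI_support ι x hx, S.xiIotaAII_support (srev ι) x hx]; ring),
    nobleDelta, if_neg hx0]
  ring

/-- `Φ^α = Φ^α(0) δ + Φ^α(e_η) · NN` ((4.18)–(4.19): a TRS function supported in the unit ball).
[cite: FitznerVanDerHofstad2016NoBLE, §4.1.3 (4.18)–(4.19) (p. 1083)] -/
theorem noblePhiAlpha_eq (h41 : NobleAssumption41At d p S)
    (hTRS : IsTRS (fun x => ∑ ι, S.xiIotaAI ι (x + 𝐞 ι))) (η : Fin d × Bool) (x : Site d) :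
    noblePhiAlpha S x = noblePhiAlpha S 0 * nobleDelta x + noblePhiAlpha S (𝐞 η) * nobleNN x :=
  (isTRS_noblePhiAlpha h41 hTRS).eq_delta_add_nn (fun x hx => noblePhiAlpha_support S x hx) η x

/-- **`Φ_p − c_Φ δ − α_Φ D = R_Φ`** with `c_Φ := Φ^α(0)` and `α_Φ := 2d Φ^α(e_η)`.
[cite: FitznerVanDerHofstad2016NoBLE, §4.1.3 (4.17)–(4.19) and R_Φ (p. 1083)] -/
theorem nobleRem_noblePhi_eq [NeZero d] {P X : ℝ} (h : NobleL1At d p P X) (h41 : NobleAssumption41At d p S)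
    (hTRS : IsTRS (fun x => ∑ ι, S.xiIotaAI ι (x + 𝐞 ι)))
    (hΞ : ∀ x, Summable fun N => nobleXiN d p N x)
    (hΞι : ∀ ι x, Summable fun N => nobleXiIotaN d p (𝐞 ι) N x) (η : Fin d × Bool) (x : Site d) :
    nobleRem (noblePhi d p) (noblePhiAlpha S 0) (2 * d * noblePhiAlpha S (𝐞 η)) x = noblePhiRem S x := by
  have hd0 : (2 * d : ℝ) ≠ 0 := mul_ne_zero two_ne_zero (Nat.cast_ne_zero.2 (NeZero.ne d))
  rw [nobleRem, noblePhi_eq_alpha_add_rem h S hΞ hΞι x, noblePhiAlpha_eq h41 hTRS η x,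
    mul_div_cancel_left₀ _ hd0]
  ring

/-- `Φ^α(0) = 1 + (Ξ_α^{(0)} − Ξ_α^{(1)})(0) − μ/(1−μ²) Σ_ι (Ξ^{(0),ι}_{α,I}(e_ι) − μ Ξ^{(0),−ι}_{α,II}(0))` (4.18).
[cite: FitznerVanDerHofstad2016NoBLE, §4.1.3 (4.18) (p. 1083)] -/
theorem noblePhiAlpha_zero (S : NobleSplit d p) : noblePhiAlpha S 0 = 1 + (S.xiA 0 0 - S.xiA 1 0) -
    nobleMu d p * (1 - nobleMu d p ^ 2)⁻¹ * ∑ ι, (S.xiIotaAI ι (𝐞 ι) - nobleMu d p * S.xiIotaAII (srev ι) 0) := by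
  rw [noblePhiAlpha, nobleDelta, if_pos rfl]
  simp only [zero_add]

/-- `Φ^α(e_η) = (Ξ_α^{(0)} − Ξ_α^{(1)})(e_η) − μ/(1−μ²) Σ_ι (Ξ^{(0),ι}_{α,I}(e_η+e_ι) − μ Ξ^{(0),−ι}_{α,II}(e_η))` (4.19).
[cite: FitznerVanDerHofstad2016NoBLE, §4.1.3 (4.19) (p. 1083)] -/
theorem noblePhiAlpha_stepVec (S : NobleSplit d p) (η : Fin d × Bool) :
    noblePhiAlpha S (𝐞 η) = (S.xiA 0 (𝐞 η) - S.xiA 1 (𝐞 η)) -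
      nobleMu d p * (1 - nobleMu d p ^ 2)⁻¹ *
        ∑ ι, (S.xiIotaAI ι (𝐞 η + 𝐞 ι) - nobleMu d p * S.xiIotaAII (srev ι) (𝐞 η)) := by
  rw [noblePhiAlpha, nobleDelta, if_neg (stepVec_ne_zero_site η), zero_add]

/-! ### Monotonicity of the `μ`-prefactors (`μ_p ≤ μ̄` of Assumption 4.3 (4.36)) -/

/-- `μ/(1−μ²)` is increasing on `[0,1)`. [folklore] -/
theorem mu_div_one_sub_sq_mono {μ m : ℝ} (h0 : 0 ≤ μ) (h1 : μ ≤ m) (h2 : m < 1) :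
    μ * (1 - μ ^ 2)⁻¹ ≤ m / (1 - m ^ 2) := by
  have hm0 : 0 ≤ m := h0.trans h1
  have hμ2 : 0 < 1 - μ ^ 2 := by nlinarith
  have hm2 : 0 < 1 - m ^ 2 := by nlinarith
  rw [← div_eq_mul_inv, div_le_iff₀ hμ2, div_mul_eq_mul_div, le_div_iff₀ hm2]
  nlinarith [mul_nonneg (sub_nonneg.2 h1) (mul_nonneg h0 hm0)]

/-! ### (D.2): `c̲_Φ ≤ c_Φ ≤ c̄_Φ` -/

/-- **(D.2)**: `c̲_Φ(μ̄,…) ≤ c_Φ = Φ^α(0) ≤ c̄_Φ(μ̄,…)` with the tree's `betaCPhiLow` / `betaCPhiUp` evaluated at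
the Assumption-4.3 constants (`μ_p ≤ i.mu`). [cite: FitznerVanDerHofstad2016NoBLE, App. D Step 1 (D.2) (p. 1111)] -/
theorem noble_cPhi_bounds (hWF : NobleInputsWF d i) (h43 : NobleAssumption43At d p S i) :
    BetaMap.betaCPhiLow d i.mu i.xiAlphaOneMinusZeroAtZero i.xiIotaAlphaIAtEi ≤ noblePhiAlpha S 0 ∧
      noblePhiAlpha S 0 ≤ (BetaMap.nobleBetaOfInputs d i).cΦup := by
  have hμ0 := nobleMu_nonneg d p
  have hμm := h43.mu_le
  have hm1 := hWF.1.mu_lt_one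
  have hN := hWF.1.toNonneg
  have hc := mu_div_one_sub_sq_mono hμ0 hμm hm1
  have hc0 : 0 ≤ nobleMu d p * (1 - nobleMu d p ^ 2)⁻¹ :=
    mul_nonneg hμ0 (inv_pos.2 (by nlinarith)).le
  have hm0 : 0 ≤ i.mu := hμ0.trans hμm
  have hcm0 : 0 ≤ i.mu / (1 - i.mu ^ 2) := div_nonneg hm0 (by nlinarith)
  -- the two sums
  have hSI : ∑ ι : Fin d × Bool, S.xiIotaAI ι (𝐞 ι) ≤ 2 * d * i.xiIotaAlphaIAtEi := by
    refine (Finset.sum_le_sum fun ι _ => h43.xiIotaAlphaIAtEi ι).trans ?_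
    rw [sum_const_dir]
  have hSII : ∑ ι : Fin d × Bool, S.xiIotaAII (srev ι) 0 ≤ 2 * d * i.xiIotaAlphaIIAtZero := by
    refine (Finset.sum_le_sum fun ι _ => h43.xiIotaAlphaIIAtZero (srev ι)).trans ?_
    rw [sum_const_dir]
  have hSI0 : 0 ≤ ∑ ι : Fin d × Bool, S.xiIotaAI ι (𝐞 ι) := Finset.sum_nonneg fun ι _ => S.xiIotaAI_nonneg ι _
  have hSII0 : 0 ≤ ∑ ι : Fin d × Bool, S.xiIotaAII (srev ι) 0 :=
    Finset.sum_nonneg fun ι _ => S.xiIotaAII_nonneg _ _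
  rw [noblePhiAlpha_zero, Finset.sum_sub_distrib, ← Finset.mul_sum]
  constructor
  · -- lower bound
    have h1 : nobleMu d p * (1 - nobleMu d p ^ 2)⁻¹ *
        ((∑ ι : Fin d × Bool, S.xiIotaAI ι (𝐞 ι)) - nobleMu d p * ∑ ι : Fin d × Bool, S.xiIotaAII (srev ι) 0) ≤
        i.mu / (1 - i.mu ^ 2) * (2 * d * i.xiIotaAlphaIAtEi) := by
      calc _ ≤ nobleMu d p * (1 - nobleMu d p ^ 2)⁻¹ * ∑ ι : Fin d × Bool, S.xiIotaAI ι (𝐞 ι) :=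
            mul_le_mul_of_nonneg_left (by nlinarith [mul_nonneg hμ0 hSII0]) hc0
        _ ≤ i.mu / (1 - i.mu ^ 2) * (2 * d * i.xiIotaAlphaIAtEi) := mul_le_mul hc hSI hSI0 hcm0
    have h2 := h43.xiAlphaAtZero_lower
    unfold BetaMap.betaCPhiLow
    have h3 : 2 * (d : ℝ) * i.mu / (1 - i.mu ^ 2) * i.xiIotaAlphaIAtEi =
        i.mu / (1 - i.mu ^ 2) * (2 * d * i.xiIotaAlphaIAtEi) := by ring
    linarith
  · -- upper bound
    have h1 : -(nobleMu d p * (1 - nobleMu d p ^ 2)⁻¹ *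
        ((∑ ι : Fin d × Bool, S.xiIotaAI ι (𝐞 ι)) - nobleMu d p * ∑ ι : Fin d × Bool, S.xiIotaAII (srev ι) 0)) ≤
        i.mu ^ 2 / (1 - i.mu ^ 2) * (2 * d * i.xiIotaAlphaIIAtZero) := by
      have e1 : -(nobleMu d p * (1 - nobleMu d p ^ 2)⁻¹ *
          ((∑ ι : Fin d × Bool, S.xiIotaAI ι (𝐞 ι)) - nobleMu d p * ∑ ι : Fin d × Bool, S.xiIotaAII (srev ι) 0)) ≤
          nobleMu d p * (1 - nobleMu d p ^ 2)⁻¹ * (nobleMu d p * ∑ ι : Fin d × Bool, S.xiIotaAII (srev ι) 0) := by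
        nlinarith [mul_nonneg hc0 hSI0]
      have e2 : nobleMu d p * (1 - nobleMu d p ^ 2)⁻¹ * (nobleMu d p * ∑ ι : Fin d × Bool, S.xiIotaAII (srev ι) 0)
          ≤ i.mu / (1 - i.mu ^ 2) * (i.mu * (2 * d * i.xiIotaAlphaIIAtZero)) :=
        mul_le_mul hc (mul_le_mul hμm hSII hSII0 hm0) (mul_nonneg hμ0 hSII0) hcm0
      have e3 : i.mu / (1 - i.mu ^ 2) * (i.mu * (2 * d * i.xiIotaAlphaIIAtZero)) =
          i.mu ^ 2 / (1 - i.mu ^ 2) * (2 * d * i.xiIotaAlphaIIAtZero) := by ring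
      linarith
    have h2 := h43.xiAlphaAtZero_upper
    show _ ≤ BetaMap.betaCPhiUp (d : ℝ) i.mu i.xiAlphaZeroMinusOneAtZero i.xiIotaAlphaIIAtZero
    unfold BetaMap.betaCPhiUp
    have h3 : 2 * (d : ℝ) * i.mu ^ 2 / (1 - i.mu ^ 2) * i.xiIotaAlphaIIAtZero =
        i.mu ^ 2 / (1 - i.mu ^ 2) * (2 * d * i.xiIotaAlphaIIAtZero) := by ring
    linarith

/-! ### (D.4): `|α_Φ| ≤ β_{α_Φ}` -/

/-- **(D.4)**: `−β^{I} ≤ α_Φ = 2d Φ^α(e_η) ≤ β^{II}`, hence `|α_Φ| ≤ max(β^{I}, β^{II}) = β_{α_Φ}` (the tree's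
`betaapI`/`betaapII` at the Assumption-4.3 constants). [cite: FitznerVanDerHofstad2016NoBLE, App. D Step 1 (D.4) (p. 1111)] -/
theorem noble_alphaPhi_bound (hWF : NobleInputsWF d i) (h41 : NobleAssumption41At d p S)
    (h43 : NobleAssumption43At d p S i) (hTRS : IsTRS (fun x => ∑ ι, S.xiIotaAI ι (x + 𝐞 ι)))
    (η : Fin d × Bool) :
    |2 * d * noblePhiAlpha S (𝐞 η)| ≤ (BetaMap.nobleBetaOfInputs d i).βαΦ := by
  have hμ0 := nobleMu_nonneg d p
  have hμm := h43.mu_le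
  have hm1 := hWF.1.mu_lt_one
  have hN := hWF.1.toNonneg
  have hc := mu_div_one_sub_sq_mono hμ0 hμm hm1
  have hc0 : 0 ≤ nobleMu d p * (1 - nobleMu d p ^ 2)⁻¹ :=
    mul_nonneg hμ0 (inv_pos.2 (by nlinarith)).le
  have hm0 : 0 ≤ i.mu := hμ0.trans hμm
  have hcm0 : 0 ≤ i.mu / (1 - i.mu ^ 2) := div_nonneg hm0 (by nlinarith)
  -- a := shifted α_I-sum, b := α_II-sum: TRS ⇒ 2d a(e_η) = Σ_κ a(e_κ)
  set a : Site d → ℝ := fun x => ∑ ι, S.xiIotaAI ι (x + 𝐞 ι) with ha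
  set b : Site d → ℝ := fun x => ∑ ι, S.xiIotaAII (srev ι) x with hb
  have ha2 : 2 * d * a (𝐞 η) = ∑ κ : Fin d × Bool, a (𝐞 κ) := hTRS.two_d_mul_apply_stepVec η
  have hb2 : 2 * d * b (𝐞 η) = ∑ κ : Fin d × Bool, b (𝐞 κ) :=
    (isTRS_sum_xiIotaAII_srev h41).two_d_mul_apply_stepVec η
  have haU : 2 * d * a (𝐞 η) ≤ 2 * d * i.xiIotaAlphaISumAroundEi := by
    rw [ha2]
    calc ∑ κ : Fin d × Bool, a (𝐞 κ) = ∑ ι : Fin d × Bool, ∑ κ : Fin d × Bool, S.xiIotaAI ι (𝐞 ι + 𝐞 κ) := by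
          simp only [ha]
          rw [Finset.sum_comm]
          exact Finset.sum_congr rfl fun ι _ => Finset.sum_congr rfl fun κ _ => by rw [add_comm]
      _ ≤ ∑ ι : Fin d × Bool, i.xiIotaAlphaISumAroundEi := Finset.sum_le_sum fun ι _ => h43.xiIotaAlphaISumAroundEi ι
      _ = 2 * d * i.xiIotaAlphaISumAroundEi := by
          rw [sum_const_dir]
  have hbU : 2 * d * b (𝐞 η) ≤ 2 * d * i.xiIotaAlphaIISumAroundZero := by
    rw [hb2]
    calc ∑ κ : Fin d × Bool, b (𝐞 κ) = ∑ ι : Fin d × Bool, ∑ κ : Fin d × Bool, S.xiIotaAII ι (𝐞 κ) := by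
          simp only [hb]
          rw [Finset.sum_comm]
          exact Fintype.sum_equiv (srevEquiv d) _ _ fun ι => by simp only [srevEquiv, Equiv.coe_fn_mk]
      _ ≤ ∑ ι : Fin d × Bool, i.xiIotaAlphaIISumAroundZero :=
          Finset.sum_le_sum fun ι _ => h43.xiIotaAlphaIISumAroundZero ι
      _ = 2 * d * i.xiIotaAlphaIISumAroundZero := by
          rw [sum_const_dir]
  have ha0 : 0 ≤ a (𝐞 η) := Finset.sum_nonneg fun ι _ => S.xiIotaAI_nonneg _ _
  have hb0 : 0 ≤ b (𝐞 η) := Finset.sum_nonneg fun ι _ => S.xiIotaAII_nonneg _ _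
  have hd0 : (0 : ℝ) ≤ 2 * d := by positivity
  -- α_Φ = 2d (Ξ_α^{(0)} − Ξ_α^{(1)})(e_η) − c (2d a(e_η)) + c μ (2d b(e_η))
  have hαeq : 2 * d * noblePhiAlpha S (𝐞 η) = 2 * d * (S.xiA 0 (𝐞 η) - S.xiA 1 (𝐞 η)) -
      nobleMu d p * (1 - nobleMu d p ^ 2)⁻¹ * (2 * d * a (𝐞 η)) +
      nobleMu d p * (1 - nobleMu d p ^ 2)⁻¹ * nobleMu d p * (2 * d * b (𝐞 η)) := by
    rw [noblePhiAlpha_stepVec, Finset.sum_sub_distrib, ← Finset.mul_sum]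
    simp only [ha, hb]
    ring
  have hup : 2 * d * noblePhiAlpha S (𝐞 η) ≤
      BetaMap.betaapII d i.mu i.xiAlphaZeroMinusOneAtEi i.xiIotaAlphaIISumAroundZero := by
    have e1 := h43.xiAlphaAtEi_upper η
    have e2 : nobleMu d p * (1 - nobleMu d p ^ 2)⁻¹ * nobleMu d p * (2 * d * b (𝐞 η)) ≤
        i.mu / (1 - i.mu ^ 2) * i.mu * (2 * d * i.xiIotaAlphaIISumAroundZero) :=
      mul_le_mul (mul_le_mul hc hμm hμ0 hcm0) hbU (mul_nonneg hd0 hb0) (mul_nonneg hcm0 hm0)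
    have e3 : BetaMap.betaapII d i.mu i.xiAlphaZeroMinusOneAtEi i.xiIotaAlphaIISumAroundZero =
        2 * d * i.xiAlphaZeroMinusOneAtEi + i.mu / (1 - i.mu ^ 2) * i.mu * (2 * d * i.xiIotaAlphaIISumAroundZero) := by
      unfold BetaMap.betaapII; ring
    rw [hαeq, e3]
    nlinarith [mul_nonneg hc0 (mul_nonneg hd0 ha0)]
  have hlow : -BetaMap.betaapI d i.mu i.xiAlphaOneMinusZeroAtEi i.xiIotaAlphaISumAroundEi ≤
      2 * d * noblePhiAlpha S (𝐞 η) := by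
    have e1 := h43.xiAlphaAtEi_lower η
    have e2 : nobleMu d p * (1 - nobleMu d p ^ 2)⁻¹ * (2 * d * a (𝐞 η)) ≤
        i.mu / (1 - i.mu ^ 2) * (2 * d * i.xiIotaAlphaISumAroundEi) :=
      mul_le_mul hc haU (mul_nonneg hd0 ha0) hcm0
    have e3 : BetaMap.betaapI d i.mu i.xiAlphaOneMinusZeroAtEi i.xiIotaAlphaISumAroundEi =
        2 * d * i.xiAlphaOneMinusZeroAtEi + i.mu / (1 - i.mu ^ 2) * (2 * d * i.xiIotaAlphaISumAroundEi) := by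
      unfold BetaMap.betaapI; ring
    rw [hαeq, e3]
    nlinarith [mul_nonneg (mul_nonneg hc0 hμ0) (mul_nonneg hd0 hb0)]
  show _ ≤ max (BetaMap.betaapI (d : ℝ) i.mu i.xiAlphaOneMinusZeroAtEi i.xiIotaAlphaISumAroundEi)
    (BetaMap.betaapII (d : ℝ) i.mu i.xiAlphaZeroMinusOneAtEi i.xiIotaAlphaIISumAroundZero)
  exact abs_le.2 ⟨by linarith [le_max_left (BetaMap.betaapI (d : ℝ) i.mu i.xiAlphaOneMinusZeroAtEi
    i.xiIotaAlphaISumAroundEi) (BetaMap.betaapII (d : ℝ) i.mu i.xiAlphaZeroMinusOneAtEi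
    i.xiIotaAlphaIISumAroundZero)], hup.trans (le_max_right _ _)⟩

end PhiAlpha

/-! ## Part F. (D.14): the explicit `ℓ¹` bound is dominated by the tree's `betaRp` -/

section PhiRp

variable {p : unitInterval} {i : BetaMap.Inputs} {S : NobleSplit d p}

set_option maxHeartbeats 800000 in
/-- The arithmetic of (D.13)–(D.14): replacing `μ_p ↦ μ̄ =: m`, `p ↦ μ̄-bound`, `p/μ_p ↦ β_{μ̄/μ}` (monotonicity
of `μ/(1−μ)`, `μ/(1−μ²)`, `1/(1−μ)`, `θ/(1−θ)`) turns the explicit bound into `General.nb`'s `betaRp` with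
the percolation factors `(2d−1)/(2d)`. [cite: FitznerVanDerHofstad2016NoBLE, App. D (D.13)–(D.14) (pp. 1112–1113);
FitznerVanDerHofstad2017, §2.5 (Percolation.nb wiring of (D.14))] -/
theorem betaRp_ge_explicit {dd μ m q mo mub X xiAbs RI RII G XR X2 : ℝ} (hdd : 1 ≤ dd)
    (hμ0 : 0 ≤ μ) (hμm : μ ≤ m) (hm1 : m < 1) (hq0 : 0 ≤ q) (hqm : q ≤ mub) (hmo : 0 ≤ mo) (hqo : q ≤ mo * μ)
    (hX : 0 ≤ X) (hxi : 0 ≤ xiAbs) (hRI : 0 ≤ RI) (hRII : 0 ≤ RII) (hG : 0 ≤ G)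
    (htmp : (2 * dd - 1) * mub * X / (1 - m) < 1) :
    XR + X2 +
      2 * dd * (μ * (1 - μ ^ 2)⁻¹ * (RI + μ * RII) + μ * (1 - μ ^ 2)⁻¹ * (1 + μ) * G +
        μ * ((2 * dd - 1) * q * X / (1 - μ) * ((1 - μ ^ 2)⁻¹ * ((1 + μ) * X)) /
          (1 - (2 * dd - 1) * q * X / (1 - μ)))) +
      μ * ((1 - μ ^ 2)⁻¹ * ((1 + μ) * X) +
        (2 * dd - 1) * q * X / (1 - μ) * ((1 - μ ^ 2)⁻¹ * ((1 + μ) * X)) /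
          (1 - (2 * dd - 1) * q * X / (1 - μ))) * ((2 * dd - 1) * (q / μ) * xiAbs)
    ≤ BetaMap.betaRp dd m ((2 * dd - 1) / (2 * dd) * mo) ((2 * dd - 1) / (2 * dd) * mub) xiAbs XR X2 X G RI RII := by
  have hm0 : 0 ≤ m := hμ0.trans hμm
  have h1m : 0 < 1 - m := by linarith
  have h1μ : 0 < 1 - μ := by linarith
  have hmsq : m ^ 2 ≤ m := by rw [sq]; exact mul_le_of_le_one_right hm0 hm1.le
  have hμsq : μ ^ 2 ≤ μ := by rw [sq]; exact mul_le_of_le_one_right hμ0 (hμm.trans hm1.le)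
  have h1m2 : 0 < 1 - m ^ 2 := by linarith
  have h1μ2 : 0 < 1 - μ ^ 2 := by linarith
  have h1μ' : (1 - μ) ≠ 0 := h1μ.ne'
  have h1μ2' : (1 - μ ^ 2) ≠ 0 := h1μ2.ne'
  have h1m' : (1 - m) ≠ 0 := h1m.ne'
  have hdd0 : 0 < dd := by linarith
  have hdd' : (2 * dd) ≠ 0 := by positivity
  have h2d1 : 0 ≤ 2 * dd - 1 := by linarith
  -- c ≤ cm
  have hc := mu_div_one_sub_sq_mono hμ0 hμm hm1
  have hc0 : 0 ≤ μ * (1 - μ ^ 2)⁻¹ := mul_nonneg hμ0 (inv_pos.2 h1μ2).le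
  have hcm0 : 0 ≤ m / (1 - m ^ 2) := div_nonneg hm0 h1m2.le
  -- U = X/(1−μ) ≤ X/(1−m)
  have hU : (1 - μ ^ 2)⁻¹ * ((1 + μ) * X) = X / (1 - μ) := by
    have : (1 : ℝ) - μ ^ 2 = (1 - μ) * (1 + μ) := by ring
    rw [this]
    field_simp
  rw [hU]
  have hUm : X / (1 - μ) ≤ X / (1 - m) := div_le_div_of_nonneg_left hX h1m (by linarith)
  have hU0 : 0 ≤ X / (1 - μ) := div_nonneg hX h1μ.le
  -- θ ≤ t1 < 1
  set θ := (2 * dd - 1) * q * X / (1 - μ) with hθ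
  set t1 := (2 * dd - 1) * mub * X / (1 - m) with ht1
  have hθ0 : 0 ≤ θ := div_nonneg (by positivity) h1μ.le
  have hθt : θ ≤ t1 := by
    rw [hθ, ht1, div_le_div_iff₀ h1μ h1m]
    have e1 : (2 * dd - 1) * q * X ≤ (2 * dd - 1) * mub * X :=
      mul_le_mul_of_nonneg_right (mul_le_mul_of_nonneg_left hqm h2d1) hX
    have e0 : 0 ≤ (2 * dd - 1) * mub * X := mul_nonneg (mul_nonneg h2d1 (hq0.trans hqm)) hX
    calc (2 * dd - 1) * q * X * (1 - m) ≤ (2 * dd - 1) * mub * X * (1 - m) :=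
          mul_le_mul_of_nonneg_right e1 h1m.le
      _ ≤ (2 * dd - 1) * mub * X * (1 - μ) := mul_le_mul_of_nonneg_left (by linarith) e0
  have hθ1 : θ < 1 := hθt.trans_lt htmp
  have hfrac : θ / (1 - θ) ≤ t1 / (1 - t1) := by
    have e1 : 0 < 1 - θ := by linarith
    have e2 : 0 < 1 - t1 := by linarith
    rw [div_le_div_iff₀ e1 e2]
    nlinarith
  have hfrac0 : 0 ≤ θ / (1 - θ) := div_nonneg hθ0 (by linarith)
  -- μ (q/μ) ≤ q ≤ mo m
  have hμq : μ * (q / μ) ≤ q := by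
    rcases eq_or_lt_of_le hμ0 with h | h
    · rw [← h]; simp [hq0]
    · rw [mul_div_cancel₀ _ h.ne']
  have hμq0 : 0 ≤ μ * (q / μ) := mul_nonneg hμ0 (div_nonneg hq0 hμ0)
  have hA : μ * (q / μ) ≤ mo * m := hμq.trans (hqo.trans (mul_le_mul_of_nonneg_left hμm hmo))
  -- unfold the target and normalise `tmp1`
  simp only [BetaMap.betaRp]
  have htmp1 : 2 * dd * ((2 * dd - 1) / (2 * dd) * mub) / (1 - m) * X = t1 := by
    rw [ht1]; field_simp
  rw [htmp1]
  -- piece 2a : the `μ/(1−μ²)`-terms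
  have p2a : 2 * dd * (μ * (1 - μ ^ 2)⁻¹ * (RI + μ * RII) + μ * (1 - μ ^ 2)⁻¹ * (1 + μ) * G) ≤
      2 * dd * m / (1 - m ^ 2) * (RI + m * RII + (1 + m) * G) := by
    have h1 : μ * (1 - μ ^ 2)⁻¹ * (RI + μ * RII) ≤ m / (1 - m ^ 2) * (RI + m * RII) :=
      mul_le_mul hc (add_le_add le_rfl (mul_le_mul_of_nonneg_right hμm hRII))
        (add_nonneg hRI (mul_nonneg hμ0 hRII)) hcm0
    have h2 : μ * (1 - μ ^ 2)⁻¹ * (1 + μ) * G ≤ m / (1 - m ^ 2) * (1 + m) * G :=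
      mul_le_mul_of_nonneg_right (mul_le_mul hc (by linarith) (by linarith) hcm0) hG
    have h3 : 2 * dd * m / (1 - m ^ 2) * (RI + m * RII + (1 + m) * G) =
        2 * dd * (m / (1 - m ^ 2) * (RI + m * RII) + m / (1 - m ^ 2) * (1 + m) * G) := by ring
    rw [h3]
    exact mul_le_mul_of_nonneg_left (add_le_add h1 h2) (by linarith)
  -- piece 2b : the `Ψ ⋆ w` term
  have p2b : μ * (X / (1 - μ)) * ((2 * dd - 1) * (q / μ) * xiAbs) ≤
      2 * dd * m / (1 - m) * ((2 * dd - 1) / (2 * dd) * mo) * xiAbs * X := by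
    have lhs_eq : μ * (X / (1 - μ)) * ((2 * dd - 1) * (q / μ) * xiAbs) =
        (2 * dd - 1) * (μ * (q / μ)) * xiAbs * (X / (1 - μ)) := by ring
    have rhs_eq : 2 * dd * m / (1 - m) * ((2 * dd - 1) / (2 * dd) * mo) * xiAbs * X =
        (2 * dd - 1) * (mo * m) * xiAbs * (X / (1 - m)) := by
      field_simp
    rw [lhs_eq, rhs_eq]
    have e1 : (2 * dd - 1) * (μ * (q / μ)) * xiAbs ≤ (2 * dd - 1) * (mo * m) * xiAbs :=
      mul_le_mul_of_nonneg_right (mul_le_mul_of_nonneg_left hA h2d1) hxi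
    exact mul_le_mul e1 hUm hU0 (by positivity)
  -- piece 3 : the Neumann tail
  have p3 : 2 * dd * (μ * (θ * (X / (1 - μ)) / (1 - θ))) +
      μ * (θ * (X / (1 - μ)) / (1 - θ)) * ((2 * dd - 1) * (q / μ) * xiAbs) ≤
      2 * dd * m * X / (1 - m) * (1 + (2 * dd - 1) / (2 * dd) * mo * xiAbs) / (1 - t1) * t1 := by
    have lhs_eq : 2 * dd * (μ * (θ * (X / (1 - μ)) / (1 - θ))) +
        μ * (θ * (X / (1 - μ)) / (1 - θ)) * ((2 * dd - 1) * (q / μ) * xiAbs) =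
        (2 * dd * μ + (2 * dd - 1) * (μ * (q / μ)) * xiAbs) * (X / (1 - μ)) * (θ / (1 - θ)) := by ring
    have rhs_eq : 2 * dd * m * X / (1 - m) * (1 + (2 * dd - 1) / (2 * dd) * mo * xiAbs) / (1 - t1) * t1 =
        (2 * dd * m + (2 * dd - 1) * (mo * m) * xiAbs) * (X / (1 - m)) * (t1 / (1 - t1)) := by
      have h1t : (1 - t1) ≠ 0 := by linarith
      field_simp
    rw [lhs_eq, rhs_eq]
    have hF1 : 2 * dd * μ + (2 * dd - 1) * (μ * (q / μ)) * xiAbs ≤ 2 * dd * m + (2 * dd - 1) * (mo * m) * xiAbs := by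
      have e1 := mul_le_mul_of_nonneg_right (mul_le_mul_of_nonneg_left hA h2d1) hxi
      have e2 := mul_le_mul_of_nonneg_left hμm (show (0 : ℝ) ≤ 2 * dd by linarith)
      linarith
    have hF1_0 : 0 ≤ 2 * dd * μ + (2 * dd - 1) * (μ * (q / μ)) * xiAbs :=
      add_nonneg (mul_nonneg (by linarith) hμ0) (mul_nonneg (mul_nonneg h2d1 hμq0) hxi)
    have hF2_0 : 0 ≤ 2 * dd * m + (2 * dd - 1) * (mo * m) * xiAbs :=
      add_nonneg (mul_nonneg (by linarith) hm0) (mul_nonneg (mul_nonneg h2d1 (mul_nonneg hmo hm0)) hxi)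
    exact mul_le_mul (mul_le_mul hF1 hUm hU0 hF2_0) hfrac hfrac0 (mul_nonneg hF2_0 (div_nonneg hX h1m.le))
  -- combine
  have split : XR + X2 +
      2 * dd * (μ * (1 - μ ^ 2)⁻¹ * (RI + μ * RII) + μ * (1 - μ ^ 2)⁻¹ * (1 + μ) * G +
        μ * (θ * (X / (1 - μ)) / (1 - θ))) +
      μ * (X / (1 - μ) + θ * (X / (1 - μ)) / (1 - θ)) * ((2 * dd - 1) * (q / μ) * xiAbs) =
      (XR + X2) + 2 * dd * (μ * (1 - μ ^ 2)⁻¹ * (RI + μ * RII) + μ * (1 - μ ^ 2)⁻¹ * (1 + μ) * G) +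
        μ * (X / (1 - μ)) * ((2 * dd - 1) * (q / μ) * xiAbs) +
        (2 * dd * (μ * (θ * (X / (1 - μ)) / (1 - θ))) +
          μ * (θ * (X / (1 - μ)) / (1 - θ)) * ((2 * dd - 1) * (q / μ) * xiAbs)) := by ring
  rw [split]
  linarith

/-- **(D.14)**: `Σ_x |R_{Φ,p}(x)| ≤ β_{R_Φ}` — the explicit bound is at most the tree's `βRΦ = betaRp(…)`.
[cite: FitznerVanDerHofstad2016NoBLE, App. D (D.14) (p. 1113)] -/
theorem noblePhiRemBound_le (hd : 2 ≤ d) (hWF : NobleInputsWF d i) (h43 : NobleAssumption43At d p S i) :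
    noblePhiRemBound d p i ((2 * d - 1) * ((p : ℝ) / nobleMu d p) * i.xiAbs) ≤
      (BetaMap.nobleBetaOfInputs d i).βRΦ := by
  have hN := hWF.1.toNonneg
  have htmp2 := hWF.1.tmp2_lt_one
  have hm1 := hWF.1.mu_lt_one
  have hX0 : 0 ≤ i.xiIotaAbs := hN.xiIotaAbs
  have hmub : 0 ≤ i.mub := hN.mub
  have htmp : (2 * (d : ℝ) - 1) * i.mub * i.xiIotaAbs / (1 - i.mu) < 1 := by
    have e : 2 * (d : ℝ) * i.mub / (1 - i.mu) * i.xiIotaAbs - (2 * (d : ℝ) - 1) * i.mub * i.xiIotaAbs / (1 - i.mu) =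
        i.mub * i.xiIotaAbs / (1 - i.mu) := by ring
    have e0 : 0 ≤ i.mub * i.xiIotaAbs / (1 - i.mu) := div_nonneg (mul_nonneg hmub hX0) (by linarith)
    linarith
  exact betaRp_ge_explicit (Nat.one_le_cast.2 (by omega)) (nobleMu_nonneg d p) h43.mu_le hm1 p.2.1 h43.mub_le
    hN.mubOverMu h43.mubOverMu hX0 hN.xiAbs hN.xiIotaRI0 hN.xiIotaRII0 (add_nonneg hN.xiIotaOdd hN.xiIotaEvenTail)
    htmp

end PhiRp

/-! ## Part G. Assembly: App. D Step 1 (Φ-side) as a theorem; the percolation split -/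

section Assembly

local notation "𝐞" => Literature.Probability.Percolation.stepVec

variable {p : unitInterval} {i : BetaMap.Inputs} {S : NobleSplit d p}

/-- For the percolation split of [FH17-perc] §3, the SHIFTED `α_I`-sum `x ↦ Σ_ι Ξ^{(0),ι}_{α,I}(x+e_ι)` is
totally rotationally symmetric (transport under the signed coordinate permutations; the relabelling
`(e, x) ↦ (φe, φx)` commutes with the shift because `φ` is additive). This discharges hypothesis `hTRS` of
`nobleSimplifiedFormAt_of_assumptions₂` for percolation. [cite: FitznerVanDerHofstad2017, §3.5
(arXiv:1506.07977v2 p. 32; EJP pp. 29–30)] -/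
theorem percolationNobleSplit_xiIotaAI_shift_trs (hd : 2 ≤ d) (hp : p < criticalProbI d) :
    IsTRS (fun x => ∑ ι, (percolationNobleSplit d p hd hp).xiIotaAI ι (x + 𝐞 ι)) :=
  isTRS_sum_of_relabel (fun e x => (nobleXiIotaAI0T d p e (x + e)).toReal) fun π ε e x => by
    have h1 := zdSignedPermIso_sub π ε (x + e) e
    rw [add_sub_cancel_right] at h1
    have h2 : zdSignedPermIso π ε (x + e) = zdSignedPermIso π ε x + zdSignedPermIso π ε e :=
      sub_eq_iff_eq_add.1 h1.symm
    show (nobleXiIotaAI0T d p (zdSignedPermIso π ε e) (zdSignedPermIso π ε x + zdSignedPermIso π ε e)).toReal =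
      (nobleXiIotaAI0T d p e (x + e)).toReal
    rw [← h2, nobleXiIotaAI0T_relabel _ (zdSignedPermIso_sub π ε)]

variable (hd : 2 ≤ d) (hp : p < criticalProbI d)
include hd hp

/-- **[NoBLE17, Prop. 4.5(ii) / App. D, Step 1 Φ-side — theorem form].** Under the NoBLE equation at `p`,
Assumption 4.1 for the split `S`, Assumption 4.3 at `p` with constants `i` (well-formed: `0 ≤ μ̄ < 1`, the
geometric ratio `< 1`), the TRS of the shifted `α_I`-sum (automatic for percolation, previous lemma), the sign
side conditions `(N1') 0 ≤ c̲_Φ(i)`, `(N2) β^abs_Ξ + β^abs_{Ξ^ι} < 1`, `(N3) β_Ψ(i) < 1`, and the ONE remaining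
analytic hypothesis `hF` = the F-side dispersive bound (D.3)+(D.32) `(α̲_F − β_{ΔR_F})(1 − D̂(k)) ≤ F̂(0) − F̂(k)`:
the simplified rewrite holds with the tree's β-table `nobleBetaOfInputs d i` — `c_Φ`, `α_Φ`, `R_Φ` are now
CONSTRUCTED (`Φ^α(0)`, `2dΦ^α(e_1)`, `noblePhiRem`) and (D.2), (D.4), (D.14) are PROVED.
[cite: FitznerVanDerHofstad2016NoBLE, Prop. 4.5 (p. 1088); §4.1.3 (4.15)–(4.19) (p. 1083); App. D (D.1)–(D.4),
(D.9)–(D.14) (pp. 1110–1113)] -/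
theorem nobleSimplifiedFormAt_of_assumptions₂ (hp0 : 0 < (p : ℝ)) (hWF : NobleInputsWF d i)
    (hE : PercolationNobleEquationAt d p) (h41 : NobleAssumption41At d p S) (h43 : NobleAssumption43At d p S i)
    (hTRS : IsTRS (fun x => ∑ ι, S.xiIotaAI ι (x + 𝐞 ι)))
    (hN1 : 0 ≤ BetaMap.betaCPhiLow d i.mu i.xiAlphaOneMinusZeroAtZero i.xiIotaAlphaIAtEi)
    (hN2 : i.xiAbs + i.xiIotaAbs < 1) (hN3 : (BetaMap.nobleBetaOfInputs d i).βΨ < 1)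
    (hF : ∀ k ∈ cube d, ((BetaMap.nobleBetaOfInputs d i).αFlow - (BetaMap.nobleBetaOfInputs d i).βΔ) *
      (1 - Dhat d k) ≤ cosFT (nobleF d p) 0 - cosFT (nobleF d p) k) :
    NobleSimplifiedFormAt d p (BetaMap.nobleBetaOfInputs d i) := by
  haveI : NeZero d := ⟨by omega⟩
  have h := nobleL1At_of_assumption43 hd hp hp0 h43
  set η : Fin d × Bool := (⟨0, by omega⟩, true) with hη
  have hΞ : ∀ x, Summable fun N => nobleXiN d p N x :=
    (l1_of_NSumLE (fun N x => nobleXiN_nonneg p N x) h43.xiAbs).1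
  have hΞι : ∀ ι x, Summable fun N => nobleXiIotaN d p (𝐞 ι) N x := fun ι =>
    (l1_of_NSumLE (fun N x => nobleXiIotaN_nonneg p (𝐞 ι) N x) (h43.xiIotaAbs ι)).1
  have hrem : ∀ x, nobleRem (noblePhi d p) (noblePhiAlpha S 0) (2 * d * noblePhiAlpha S (𝐞 η)) x =
      noblePhiRem S x := nobleRem_noblePhi_eq h h41 hTRS hΞ hΞι η
  obtain ⟨hcL, hcU⟩ := noble_cPhi_bounds hWF h43
  have hαΦ := noble_alphaPhi_bound hWF h41 h43 hTRS η
  have hRΦ : ∑' x, |nobleRem (noblePhi d p) (noblePhiAlpha S 0) (2 * d * noblePhiAlpha S (𝐞 η)) x| ≤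
      (BetaMap.nobleBetaOfInputs d i).βRΦ := by
    rw [tsum_congr fun x => congrArg abs (hrem x)]
    exact (noblePhiRem_l1 hd hp hp0 h43).2.trans (noblePhiRemBound_le hd hWF h43)
  have hFs := summable_abs_nobleF h
  have hΔ : ∀ k ∈ cube d, -((BetaMap.nobleBetaOfInputs d i).βΔ * (1 - Dhat d k)) ≤
      cosFT (nobleRem (nobleF d p) 0 (BetaMap.nobleBetaOfInputs d i).αFlow) 0 -
        cosFT (nobleRem (nobleF d p) 0 (BetaMap.nobleBetaOfInputs d i).αFlow) k := fun k hk => by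
    rw [cosFT_nobleRem hFs, cosFT_nobleRem hFs, Dhat_zero]
    have := hF k hk
    nlinarith
  exact nobleSimplifiedFormAt_of_assumptions hd hp hp0 hE h41 h43 hN2 hN3 (hN1.trans hcL) hcU hαΦ le_rfl hRΦ hΔ

/-- **Percolation instance** (the split of [FH17-perc] §3, `S := percolationNobleSplit d p`): Assumption 4.1
and the shifted-`α_I` TRS are theorems, so only the NoBLE equation, Assumption 4.3 with constants `i`, the
sign conditions and the F-side dispersive bound remain as hypotheses. [cite: FitznerVanDerHofstad2016NoBLE,
Prop. 4.5 (p. 1088), App. D (pp. 1110–1113); FitznerVanDerHofstad2017, §3.5] -/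
theorem nobleSimplifiedFormAt_percolation (hp0 : 0 < (p : ℝ)) (hWF : NobleInputsWF d i)
    (hE : PercolationNobleEquationAt d p) (h43 : NobleAssumption43At d p (percolationNobleSplit d p hd hp) i)
    (hN1 : 0 ≤ BetaMap.betaCPhiLow d i.mu i.xiAlphaOneMinusZeroAtZero i.xiIotaAlphaIAtEi)
    (hN2 : i.xiAbs + i.xiIotaAbs < 1) (hN3 : (BetaMap.nobleBetaOfInputs d i).βΨ < 1)
    (hF : ∀ k ∈ cube d, ((BetaMap.nobleBetaOfInputs d i).αFlow - (BetaMap.nobleBetaOfInputs d i).βΔ) *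
      (1 - Dhat d k) ≤ cosFT (nobleF d p) 0 - cosFT (nobleF d p) k) :
    NobleSimplifiedFormAt d p (BetaMap.nobleBetaOfInputs d i) :=
  nobleSimplifiedFormAt_of_assumptions₂ hd hp hp0 hWF hE (nobleAssumption41At_percolation hd p hp) h43
    (percolationNobleSplit_xiIotaAI_shift_trs hd hp) hN1 hN2 hN3 hF

end Assembly

end Literature.Probability.FitznerVanDerHofstad2017
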